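import Summits.Langlands.Langlands.Theses.AnalyticDescent
import Literature.NumberTheory.Automorphic.PairLFunctionPolesRepDataSchur
import Literature.NumberTheory.Automorphic.PairLFunctionMeromorphicContinuationProofs
import Literature.NumberTheory.Automorphic.PairLFunctionMeromorphicContinuationNeConjProofs
import Literature.NumberTheory.Automorphic.PairLFunctionMeromorphicContinuationRankNeTwistProofs
import Literature.NumberTheory.Automorphic.JPSSGlobalIntegral
import Literature.NumberTheory.Automorphic.JPSSGlobalIntegralQuotientUnfolding
import Literature.NumberTheory.Automorphic.JPSSCornerWhittakerUnfolding
import Literature.NumberTheory.Automorphic.JPSSUnfoldedPairIntegralEntire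
import Literature.NumberTheory.Automorphic.ArchRankinSelbergGapTestVector
import Literature.NumberTheory.Automorphic.AutomorphicConjugate
import Literature.NumberTheory.Automorphic.ClozelAlgebraicityComplexConjProofs
import Literature.NumberTheory.Automorphic.RankinSelbergUnfoldingIdentity
import Literature.NumberTheory.Automorphic.SmoothedAutomorphicForms
import Literature.NumberTheory.Automorphic.SiegelSetVolume
import Literature.NumberTheory.Automorphic.GLnAdelicIntegrationFacts
import Literature.NumberTheory.Automorphic.AdelicSecondCountable
import Literature.NumberTheory.Automorphic.WhittakerPeriodExchange
import Literature.NumberTheory.Automorphic.TorusIwasawaTransport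
import Literature.NumberTheory.Automorphic.CornerTorusIwasawaData
import Literature.NumberTheory.Automorphic.WhittakerCoeffHonestCuspForm
import Literature.NumberTheory.Automorphic.WhittakerCoeffTranslateUnramified
import Literature.NumberTheory.Automorphic.WhittakerDecayCuspForm
import Literature.NumberTheory.Automorphic.WhittakerSupportFinite
import Literature.NumberTheory.Automorphic.RankinSelbergUnramifiedTorus
import Literature.NumberTheory.Automorphic.RankinSelbergTorusPairEuler
import Literature.NumberTheory.Automorphic.RankinSelbergTorusHolomorphy
import Literature.NumberTheory.Automorphic.RankinSelbergTorusPairTranslate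
import Literature.NumberTheory.Automorphic.RankinSelbergTowerFiniteness
import Literature.NumberTheory.Automorphic.UnipotentTateDomain

/-!
# Line `partner` — skeleton for the crux `PairLBoundaryJS` (stmt-Langlands-13622), crux-strategist s2

ALTERNATIVE line (`--alt` semantics: it never touches the lead's line `Sketch` nor s1's `halves`).
Conclusion decl: `Summit.Langlands.Langlands.Theses.AnalyticDescent.PairLBoundaryJS` (the bet route's alias of
the shared item; same text as `…IrreducibilityBySelfDuality.PairLBoundaryJS`, `Iff.rfl`).

## Idea: an EISENSTEIN PARTNER in its region of ABSOLUTE CONVERGENCE replaces the equal-rank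
## archimedean Γ-realisation (Humphries–Jo)

The lead's composition (p81600) is `crux ⇐ PairLBoundaryJS_of_moeglinWaldspurger_of_isOrtho hA hC hB`.
Leaf hA (Mœglin–Waldspurger (i)(a), `n ≠ m`) is a theorem of the tree granted the archimedean gap fact
(`stub_gap_arch_fact`, shared with `Sketch`) and Cogdell's analytic clause (a THEOREM, p141917). The two
EQUAL-RANK leaves hB (`π ⟂ σ̄` ⇒ `L^S(s, π ⊗ σ)` entire) and hC (`π = σ̄` ⇒ `s (s-1) L^S` entire) are where
`Sketch` needs `HumphriesJo2024_archRankinSelberg_testVector` (explicit archimedean Whittaker theory of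
`GL_n(ℝ)`, `GL_n(ℂ)`; XL, no rank `≥ 2` in the tree): the `GL_n × GL_n` integral carries the test function
`Φ(e_n g)`, and its archimedean factor must be continued and made zero-free deep in the strip.

This line never forms a `GL_n × GL_n` integral. For cuspidal `σ` (= `P`) on `GL_n` it PAIRS THE OTHER CUSP
FORM `φ ∈ σ̄'` (= `P'.conj`) AGAINST A CONVERGENT EISENSTEIN SERIES `E` ON `GL_{n+1}` induced from the
standard parabolic `P_{1,n}` with cuspidal data `(|·|^b, σ)`, the real parameter `b` FIXED and large (Godement's
range: `E(g) = Σ_{γ ∈ P_{1,n}(K)\GL_{n+1}(K)} f_b(γ g)` converges absolutely; NO continuation of `E` in `b` is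
ever used). Along the corner `h ↦ diag(h, 1)` the two cusps of `E` are explicit:
`E(diag(h,1)) ≈ |det h|^{1/2} A(h)` (`|det h| → ∞`, constant term along `U_{n,1}`, `A ∈ σ`) and
`E(diag(h,1)) ≈ |det h|^{-1/2} B(h)` (`|det h| → 0`, the `P_{1,n}`-constant term transported by the block
Weyl element, `B ∈ σ`) — the `b`'s CANCEL in these exponents (central character × section growth), so the
REGULARIZED corner integral

  `J(s) = ∫_{GL_n(K)\GL_n(𝔸)} φ̄(h) [E(diag(h,1)) - 1_{|det h| ≥ 1} |det h|^{1/2} A(h) - 1_{|det h|<1} |det h|^{-1/2} B(h)] |det h|^{s-1/2} dh`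

is ENTIRE (both remainders are rapidly decreasing: Fourier expansion along the abelian radicals `U_{n,1}`,
`U_{1,n}` + uniform moderate growth of `E`), and on `Re s > 1`

  `J(s) + ⟨φ, B⟩/(c (s-1)) - ⟨φ, A⟩/(c s) = C · w_{s-1/2}(τ) · L^S(s, σ × σ̄'-data) · L^S(s + b, std) · Ψ_S(s - 1/2)`

(`c = n [K:ℚ]`): the regularized integral unfolds along the mirabolic tower of `GL_{n+1}` — the intermediate
constant terms of `E` (radicals of `P_{k,n+1-k}`, `2 ≤ k ≤ n-1`) vanish because the `GL_n`-datum is cuspidal,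
the `P_{1,n}` degenerate term dies against the cusp form `φ` (its character is trivial on the radical of
`P_{1,n-1} ⊂ GL_n`), and the corner Euler factorisation is the tree's `CornerEulerLimit.stub_corner_euler_limit`
(stated for ANY continuous torus-unramified `W` on `GL_{n+1}`). The auxiliary factor `L^S(s+b, ·)` is a
standard `L`-function in its half-plane of absolute convergence — entire and NON-VANISHING where needed
because `b` is large — and the `S`-part `Ψ_S` is made ENTIRE and non-zero at the target point by choosing the
archimedean component of the Eisenstein SECTION with compactly supported Kirillov restriction on the corner
(Jacquet's archimedean Kirillov surjectivity for the generic induced representation `I_∞(b)`; a smooth,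
non-`K_∞`-finite section — qualitative, no special functions). Hence the entire-quotient representations
feeding the tree's `exists_entire_eq_partialPairL_of_entire_quotients` (hB) and
`exists_entire_eq_mul_partialPairL_of_entire_quotients` (hC), datum by datum.

Stubs: `stub_gap_arch_fact` (shared named fact, leaf hA); two CITATION stubs that are ALREADY THEOREMS of the tree —
`stub_hA_of_archGap_cite` (= `PairLBoundaryJSOfArchFacts.partialPairL_entire_of_rank_ne_of_archGap · GapEntireFactHolds.Cogdell2004_unfoldedPairIntegral_entire_holds`,
p141340 + p141917) and `stub_corner_euler_limit_cite` (= `CornerEulerLimit.stub_corner_euler_limit`, p128318) — kept as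
hypotheses ONLY to decouple this workfile from the `IrreducibilityBySelfDuality` build chain (every Theorems file of the
corner machinery imports that route file, which six routes rewrite; it was incoherent on the farm at publication time);
each closes by a one-line citation in a Theorems file; and the line proper: `stub_partner` (existence of the Eisenstein
partner with its Whittaker/torus data, cusp terms and decay — `Nonempty (PartnerData …)`), `stub_corner_regularized`
(the regularized corner integral is entire), `stub_corner_unfolded` (the regularized corner identity). The composition
`PairLBoundaryJS_of` is PROVED below from the six stub statements (sorry-free, standard axioms), with `heart` = the
equal-rank entire-quotient representation WITH POLAR PART. (The import-based variant of this file — citing the two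
theorems directly, 5 stubs — passed `lean check` rc 0 against the snapshot and is attached as evidence #66 on the item.)

Disproof used: `pairLBoundaryJS_false_without_X` / `…_without_satakeLink` (Negative/LoadBearing) concern dropped
hypotheses of the crux; this line keeps the crux verbatim (it only re-sources the leaves hB/hC) — the
`X`-dichotomy is the tree's Schur step inside `PairLBoundaryJS_of_moeglinWaldspurger_of_isOrtho`, and every
`L`-function here is attached to honest cuspidal data (`IsSatakeFamilyOf`). No stub is an instance of a landed
Negative lemma. NegativeNoteBoundaryLocalNonvanishing §1 honoured: non-vanishing still comes from the tree's
Landau engine on the MW continuation, not from boundary inequalities.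
-/

noncomputable section

-- `Summit.Langlands.Langlands.…` (summit = sub-problem name, D-0017 layout) trips `dupNamespace`
set_option linter.dupNamespace false

open scoped MatrixGroups Topology Pointwise ENNReal NNReal ComplexConjugate InnerProductSpace ContDiff
open scoped Classical Matrix.Norms.Operator
open NumberField IsDedekindDomain MeasureTheory Measure Matrix Set Filter WithZero
open NumberField.mixedEmbedding
open Literature.NumberTheory.Automorphic AdelicGroupData
open Literature.NumberTheory.GaloisRepresentations (ideleGroup HeckeCharacter)
open Literature.MeasureTheory.Group
open Literature.RingTheory.SymmetricFunctions.SymmPoly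
open ValuativeRel

-- the automorphic quotient carries the tree's Borel σ-algebra, not Mathlib's quotient σ-algebra
attribute [-instance] Quotient.instMeasurableSpace QuotientGroup.measurableSpace

-- the house local instances, exactly as in `RankinSelbergUnfoldingIdentity`
attribute [local instance] adelicBorel borelSpace_adelic locallyCompactSpace_adelic secondCountableTopology_gl_adelic
  glAdeleBorel borelSpace_glAdele borelSpace_ideleGroup secondCountableTopology_ideleGroup

-- Mathlib idiom: the commutator Lie ring on matrices, to mention `(AutomorphyDatum.gl n K _).arch.lie`
attribute [local instance 100] LieRing.ofAssociativeRing

namespace Summit.Langlands.Langlands.Cruxes.PairLBoundaryJS.Partner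

/-! ## Definitions: the corner remainder of a function on `GL_{n+1}(𝔸_K)` and its regularized fibre integral -/

section Defs

variable {n : ℕ} {K : Type} [Field K] [NumberField K]

/-- `|det h|_𝔸` as a real number. [folklore] -/
def absDetR (h : GL (Fin n) (AdeleRing (𝓞 K) K)) : ℝ :=
  (((glAbsDet n K h : ℝ≥0ˣ) : ℝ≥0) : ℝ)

/-- The corner embedding `h ↦ diag(h, 1)` with values in the tree's adelic group type `(gl (n+1) K).Adelic`
(= `GL_{n+1}(𝔸_K)`; a typing convenience for products with `glUnipotent`). [folklore] -/
def cornerAdelic (h : GL (Fin n) (AdeleRing (𝓞 K) K)) : (AdelicGroupData.gl (n + 1) K).Adelic :=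
  glCorner (AdeleRing (𝓞 K) K) (Nat.le_succ n) h

/-- **The two-cusp corner remainder** of `E : GL_{n+1}(𝔸_K) → ℂ` with cusp terms `A`, `B` (functions on the
automorphic quotient `X_n` of `GL_n`, read on the group through `invQuot`):
`R(h) = E(diag(h,1)) - 1_{|det h| ≥ 1} |det h|^{1/2} A(h) - 1_{|det h| < 1} |det h|^{-1/2} B(h)`.
[cite: CogdellAnalyticTheory2004, §2.2] -/
def cornerRemainder (E : GL (Fin (n + 1)) (AdeleRing (𝓞 K) K) → ℂ)
    (A B : (AdelicGroupData.gl n K).automorphicQuotient → ℂ) (h : GL (Fin n) (AdeleRing (𝓞 K) K)) : ℂ :=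
  E (glCorner (AdeleRing (𝓞 K) K) (Nat.le_succ n) h) -
    (if 1 ≤ absDetR h then ((absDetR h : ℝ) : ℂ) ^ ((1 : ℂ) / 2) * invQuot (AdelicGroupData.gl n K) A h
      else ((absDetR h : ℝ) : ℂ) ^ (-((1 : ℂ) / 2)) * invQuot (AdelicGroupData.gl n K) B h)

/-- **The regularized corner fibre integral** over the split centre `A_G = {z(e^u)}` of `GL_n`:
`∫_ℝ R(z(e^u) g) |det (z(e^u) g)|_𝔸^{s - 1/2} du` (the regularized analogue of `jpssKernel`). [cite: CogdellAnalyticTheory2004, §2.2] -/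
def regKernel (E : GL (Fin (n + 1)) (AdeleRing (𝓞 K) K) → ℂ)
    (A B : (AdelicGroupData.gl n K).automorphicQuotient → ℂ) (s : ℂ) (g : GL (Fin n) (AdeleRing (𝓞 K) K)) : ℂ :=
  ∫ u : ℝ, cornerRemainder E A B (scalarExp n K u * g) *
    (((absDetR (scalarExp n K u * g) : ℝ) : ℂ) ^ (s - 1 / 2))

end Defs

/-! ## The Eisenstein partner datum -/

section Partner

variable {n : ℕ} {K : Type} [Field K] [NumberField K]
  {μ : Measure (AdelicGroupData.gl n K).automorphicQuotient} [(AdelicGroupData.gl n K).IsAutomorphicMeasure μ]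
  [MeasurableSpace (AdeleRing (𝓞 K) K)] [BorelSpace (AdeleRing (𝓞 K) K)]

/-- **An Eisenstein partner for the cuspidal pair `(σ, σ̄')` = `(P, P'.conj)` on `GL_n × GL_n`, presented through
exactly what the regularized corner argument consumes.** Intended witness: `b ≥ b₀` real and large,
`E(g) = Σ_{γ ∈ P_{1,n}(K)\GL_{n+1}(K)} f_b(γ g)` the absolutely convergent Eisenstein series on `GL_{n+1}(𝔸_K)`
induced (normalised) from the standard parabolic `P_{1,n}` with data `(|·|^b, σ)`, the section `f_b` built
from a vector of `P` spherical off `S`, with archimedean component a smooth vector of `I_∞(b)` whose Whittaker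
function has compactly supported (mod `N_n`) restriction to the corner — built from Schwartz sections on the big
Bruhat cell (smooth vectors of the induced representation), vector-valued Fourier inversion on `K_∞ⁿ` and Kirillov
surjectivity for the UNITARY generic `σ_∞` (Jacquet, Israel J. Math. 178 (2010), `ℝ`; Kemarsky, C. R. Math. 353
(2015), Thm. 1, `ℂ`) — and finite components at `S` with Jacquet–Piatetski-Shapiro–Shalika control; `A`, `B` its two constant terms read
on the corner (`A` along the radical `U_{n,1}` of `P_{n,1}`, `B` the `P_{1,n}` one transported by the block Weyl
element), both cusp forms in `P`; `φ` an honest continuous cusp form representing a vector of `P'.conj` of level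
`𝔫₀` supported in `S`; `τ` the torus of Whittaker shifts correcting the conductor of Tate's character off `S`
(as in `CornerLocalControlAsm`); `x_v = (enumeration of α_v, q_v^{-b})`, `y_v` an enumeration of `β_v`;
`Gb(s) =` the entire continuation of `L^S(s + b, β)` (Godement–Jacquet; non-vanishing on `Re s > 1 - b`,
Jacquet–Shalika (5.3)). Fields: regularity of `E` (continuity, left `GL_{n+1}(K)`-invariance, level,
archimedean smoothness with UNIFORM moderate growth of all derivatives, the intermediate cusp conditions
`2 ≤ k ≤ n-1`), the identification of `A` as the `U_{n,1}`-constant term on the corner, the representatives,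
the TWO-CUSP DECAY of the corner remainder against `φ`, the torus data of the translated Whittaker functions
(inputs of `CornerEulerLimit.stub_corner_euler_limit`), the factored Euler product of the partner pair, and
the local control of the `S`-part (entire, non-zero at `s₁ - 1/2`).
[cite: CogdellAnalyticTheory2004, §2.2, §4.1–4.2] [cite: JacquetShalikaAJM1981, §2, §4, Thm. (5.3)]
[cite: MoeglinWaldspurger1989, II.1.5–II.1.7 (convergence and constant terms of cuspidal Eisenstein series)]
[cite: Kemarsky2015, Thm. 1 (Kirillov model of generic unitary representations of GL_n(ℂ))]
[cite: Jacquet2010Distinction, §? (the same for GL_n(ℝ))] -/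
structure PartnerData (νA : Measure (Fin n → ideleGroup K)) (νK : Measure ↥(maximalCompactAdelic n K))
    (ν₀ : Measure ↥(adelicUnipotent (n + 1) K)) (ν₀' : Measure ↥(adelicUnipotent n K))
    (P P' : CuspidalAutomorphicRepGL n K μ) (S : Set (HeightOneSpectrum (𝓞 K))) (α β : SatakeFamily K)
    (b₀ : ℝ) (s₁ : ℂ) where
  /-- the Eisenstein parameter -/
  b : ℝ
  b₀_le : b₀ ≤ b
  /-- the Eisenstein series on `GL_{n+1}(𝔸_K)` (absolutely convergent range) -/
  E : GL (Fin (n + 1)) (AdeleRing (𝓞 K) K) → ℂ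
  /-- the two cusp terms on the corner and the cusp form of `P'.conj`, on the automorphic quotient of `GL_n` -/
  A : (AdelicGroupData.gl n K).automorphicQuotient → ℂ
  B : (AdelicGroupData.gl n K).automorphicQuotient → ℂ
  φ : (AdelicGroupData.gl n K).automorphicQuotient → ℂ
  svA : P.1.toSubmodule
  svB : P.1.toSubmodule
  sv : P'.conj.1.toSubmodule
  𝔫₀ : Ideal (𝓞 K)
  τ : Fin n → ideleGroup K
  ϖ : ∀ v : HeightOneSpectrum (𝓞 K), (v.adicCompletion K)ˣ
  x : HeightOneSpectrum (𝓞 K) → Fin (n + 1) → ℂ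
  y : HeightOneSpectrum (𝓞 K) → Fin n → ℂ
  /-- the entire continuation of the auxiliary standard `L`-function `L^S(s + b, β)` -/
  Gb : ℂ → ℂ
  x₁ : ℝ
  -- regularity of `E`
  continuous_E : Continuous E
  leftInvariant_E : ∀ γ ∈ rationalPointsGL (n + 1) K, ∀ g : GL (Fin (n + 1)) (AdeleRing (𝓞 K) K), E (γ * g) = E g
  level_E : ∀ u ∈ principalCongruenceLevel (n + 1) K 𝔫₀, ∀ g : GL (Fin (n + 1)) (AdeleRing (𝓞 K) K), E (g * u) = E g
  smooth_E : IsArchSmooth (AutomorphyDatum.gl (n + 1) K (isCompact_glFiniteIntegralLevel_holds (n + 1) K)).ofArch E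
  uniformGrowth_E : ∃ r : ℕ,
    ∀ l : List (AutomorphyDatum.gl (n + 1) K (isCompact_glFiniteIntegralLevel_holds (n + 1) K)).arch.lie,
      ∃ C : ℝ, ∀ g,
        ‖iterLieDeriv (AutomorphyDatum.gl (n + 1) K (isCompact_glFiniteIntegralLevel_holds (n + 1) K)).ofArch l E g‖ ≤
          C * (1 ⊔ (AutomorphyDatum.gl (n + 1) K (isCompact_glFiniteIntegralLevel_holds (n + 1) K)).height g) ^ r
  /-- the constant terms of `E` along the radicals of `P_{k,n+1-k}`, `2 ≤ k ≤ n - 1`, vanish (cuspidal `GL_n`-datum) -/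
  cuspidal_E : ∀ k, 2 ≤ k → k < n → CuspConditionGL (n + 1) K E k
  /-- `A` is the constant term of `E` along `U_{n,1}` (radical of `P_{n,1}`), read on the corner -/
  constTerm_E : ∀ (ν : Measure (blockNilpotent (n + 1) n (AdeleRing (𝓞 K) K))) [ν.IsAddHaarMeasure]
    (𝓕 : Set (blockNilpotent (n + 1) n (AdeleRing (𝓞 K) K))),
    IsAddFundamentalDomain (rationalBlock (n + 1) n K) 𝓕 ν → ∀ h : GL (Fin n) (AdeleRing (𝓞 K) K),
      IntegrableOn (fun X => E (glUnipotent (n + 1) n K (Multiplicative.ofAdd X) * cornerAdelic h)) 𝓕 ν ∧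
      ∫ X in 𝓕, E (glUnipotent (n + 1) n K (Multiplicative.ofAdd X) * cornerAdelic h) ∂ν =
        ((ν 𝓕).toReal : ℂ) * (((absDetR h : ℝ) : ℂ) ^ ((1 : ℂ) / 2) * invQuot (AdelicGroupData.gl n K) A h)
  -- the representatives
  continuous_A : Continuous A
  continuous_B : Continuous B
  continuous_φ : Continuous φ
  ae_A : (((svA : (AdelicGroupData.gl n K).L2 μ) : (AdelicGroupData.gl n K).automorphicQuotient → ℂ) =ᵐ[μ] A)
  ae_B : (((svB : (AdelicGroupData.gl n K).L2 μ) : (AdelicGroupData.gl n K).automorphicQuotient → ℂ) =ᵐ[μ] B)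
  ae_φ : (((sv : (AdelicGroupData.gl n K).L2 μ) : (AdelicGroupData.gl n K).automorphicQuotient → ℂ) =ᵐ[μ] φ)
  cuspForm_φ : IsCuspFormGL n K (isCompact_glFiniteIntegralLevel_holds n K) (invQuot (AdelicGroupData.gl n K) φ)
  level_φ : ∀ u ∈ principalCongruenceLevel n K 𝔫₀, ∀ g : GL (Fin n) (AdeleRing (𝓞 K) K),
    invQuot (AdelicGroupData.gl n K) φ (g * u) = invQuot (AdelicGroupData.gl n K) φ g
  𝔫₀_ne : 𝔫₀ ≠ 0
  𝔫₀_supp : ∀ w : HeightOneSpectrum (𝓞 K), w.asIdeal ∣ 𝔫₀ → w ∈ S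
  /-- TWO-CUSP DECAY of the corner remainder against the cusp form (rapid decay at both cusps, uniformly) -/
  decay : ∀ B₁ : ℝ, ∃ C : ℝ, ∀ h : GL (Fin n) (AdeleRing (𝓞 K) K),
    ‖invQuot (AdelicGroupData.gl n K) φ h‖ * ‖cornerRemainder E A B h‖ ≤
      C * min ((absDetR h) ^ B₁) ((absDetR h) ^ (-B₁))
  -- the translated Whittaker functions `W^τ_E` on `GL_{n+1}`, `W̄^τ_φ` on `GL_n`: inputs of `stub_corner_euler_limit`
  continuous_W : Continuous fun g => whittakerCoeff ν₀ (unipotentTateDomain (n + 1) K) (adeleAddChar K) E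
    (glDiagonal (n + 1) (AdeleRing (𝓞 K) K) (Fin.snoc τ 1) * g)
  continuous_W' : Continuous fun g => star (whittakerCoeff ν₀' (unipotentTateDomain n K) (adeleAddChar K)
    (invQuot (AdelicGroupData.gl n K) φ) (glDiagonal n (AdeleRing (𝓞 K) K) τ * g))
  central_W : ∀ (z : ideleGroup K) (g : GL (Fin (n + 1)) (AdeleRing (𝓞 K) K)),
    ‖whittakerCoeff ν₀ (unipotentTateDomain (n + 1) K) (adeleAddChar K) E
        (glDiagonal (n + 1) (AdeleRing (𝓞 K) K) (Fin.snoc τ 1) *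
          (Matrix.GeneralLinearGroup.scalar (Fin (n + 1)) z * g))‖ =
      ‖whittakerCoeff ν₀ (unipotentTateDomain (n + 1) K) (adeleAddChar K) E
        (glDiagonal (n + 1) (AdeleRing (𝓞 K) K) (Fin.snoc τ 1) * g)‖
  unram_W : ∀ v ∉ S, IsTorusUnramifiedAt (n + 1) K
    (fun g => whittakerCoeff ν₀ (unipotentTateDomain (n + 1) K) (adeleAddChar K) E
      (glDiagonal (n + 1) (AdeleRing (𝓞 K) K) (Fin.snoc τ 1) * g)) v (ϖ v) (x v)
  unram_W' : ∀ v ∉ S, IsTorusUnramifiedAt n K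
    (fun g => star (whittakerCoeff ν₀' (unipotentTateDomain n K) (adeleAddChar K)
      (invQuot (AdelicGroupData.gl n K) φ) (glDiagonal n (AdeleRing (𝓞 K) K) τ * g))) v (ϖ v) (y v)
  bound_x : ∀ v ∉ S, ∀ i, ‖x v i‖ ≤ (v.residueCard : ℝ) ^ (1 / 2 : ℝ)
  bound_y : ∀ v ∉ S, ∀ a, ‖y v a‖ ≤ (v.residueCard : ℝ) ^ (1 / 2 : ℝ)
  enum_x : ∀ v ∉ S, (Finset.univ : Finset (Fin (n + 1))).val.map (x v) =
    α v + {((v.residueCard : ℂ) ^ (-(b : ℂ)))}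
  enum_y : ∀ v ∉ S, (Finset.univ : Finset (Fin n)).val.map (y v) = β v
  integrable_pair : ∀ s : ℂ, x₁ < s.re →
    Integrable (torusPairIntegrandC n K
      (fun g => whittakerCoeff ν₀ (unipotentTateDomain (n + 1) K) (adeleAddChar K) E
        (glDiagonal (n + 1) (AdeleRing (𝓞 K) K) (Fin.snoc τ 1) * glCorner (AdeleRing (𝓞 K) K) (Nat.le_succ n) g))
      (fun g => star (whittakerCoeff ν₀' (unipotentTateDomain n K) (adeleAddChar K)
        (invQuot (AdelicGroupData.gl n K) φ) (glDiagonal n (AdeleRing (𝓞 K) K) τ * g)))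
      (fun _ => (1 : ℝ)) s) (νA.prod νK)
  -- the factored Euler product of the partner pair `L^S(s, (α, q^{-b}) × β) = L^S(s, α × β) · Gb(s)`
  differentiable_Gb : Differentiable ℂ Gb
  Gb_ne_zero : ∀ s : ℂ, 1 - b < s.re → Gb s ≠ 0
  hasProd : ∀ s : ℂ, 1 < s.re →
    HasProd (fun u : {v : HeightOneSpectrum (𝓞 K) // v ∉ S} =>
      ((satakePairPolynomial (α u.1 + {((u.1.residueCard : ℂ) ^ (-(b : ℂ)))}) (β u.1)).eval
        ((u.1.residueCard : ℂ) ^ (-s)))⁻¹) (partialPairL S α β s * Gb s)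
  -- local control of the `S`-part (archimedean: compactly supported Kirillov datum ⇒ entire; JPSS at finite places)
  differentiable_unitBox : Differentiable ℂ fun s : ℂ =>
    ∫ p in unitBox {v | v ∉ S} ×ˢ Set.univ, torusPairIntegrandC n K
      (fun g => whittakerCoeff ν₀ (unipotentTateDomain (n + 1) K) (adeleAddChar K) E
        (glDiagonal (n + 1) (AdeleRing (𝓞 K) K) (Fin.snoc τ 1) * glCorner (AdeleRing (𝓞 K) K) (Nat.le_succ n) g))
      (fun g => star (whittakerCoeff ν₀' (unipotentTateDomain n K) (adeleAddChar K)
        (invQuot (AdelicGroupData.gl n K) φ) (glDiagonal n (AdeleRing (𝓞 K) K) τ * g)))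
      (fun _ => (1 : ℝ)) s p ∂(νA.prod νK)
  unitBox_ne_zero :
    (∫ p in unitBox {v | v ∉ S} ×ˢ Set.univ, torusPairIntegrandC n K
      (fun g => whittakerCoeff ν₀ (unipotentTateDomain (n + 1) K) (adeleAddChar K) E
        (glDiagonal (n + 1) (AdeleRing (𝓞 K) K) (Fin.snoc τ 1) * glCorner (AdeleRing (𝓞 K) K) (Nat.le_succ n) g))
      (fun g => star (whittakerCoeff ν₀' (unipotentTateDomain n K) (adeleAddChar K)
        (invQuot (AdelicGroupData.gl n K) φ) (glDiagonal n (AdeleRing (𝓞 K) K) τ * g)))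
      (fun _ => (1 : ℝ)) (s₁ - 1 / 2) p ∂(νA.prod νK)) ≠ 0

end Partner

/-! ## Registered stubs -/

/-- **STUB (shared named fact, XL) — the archimedean gap fact**, exactly the lead's `stub_gap_arch_fact`: the
Literature fact `JacquetShalika1990_archRankinSelbergGap_entireRatio` (Jacquet (2009) Thm. 2.1/2.6, Prop. 12.5;
Cogdell (2004) Thm. 3.5, §4.2). It serves leaf hA ONLY (`n ≠ m`, through the landed gap road); the lead reports
it removable by global smooth-vector work. [cite: JacquetArchimedeanRS2009, Thm. 2.1, Thm. 2.6, Prop. 12.5] -/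
theorem stub_gap_arch_fact :
    ∀ (n m : ℕ) (K : Type) [Field K] [NumberField K], JacquetShalika1990_archRankinSelbergGap_entireRatio n m K := by
  sorry

/-- **CITATION STUB (already a theorem) — leaf hA from the archimedean gap fact.** LANDED as
`PairLBoundaryJSOfArchFacts.partialPairL_entire_of_rank_ne_of_archGap hGap GapEntireFactHolds.Cogdell2004_unfoldedPairIntegral_entire_holds`
(p141340, p141917: Mœglin–Waldspurger (i)(a) at all ranks `n ≠ m` from the gap road + Cogdell's analytic clause, a theorem).
Kept as a hypothesis only to avoid importing the `IrreducibilityBySelfDuality` build chain; closes by that one-line citation.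
[cite: MoeglinWaldspurger1989, Appendice, Corollaire (i)(a), p. 667] [cite: CogdellAnalyticTheory2004, Thm. 4.2] -/
theorem stub_hA_of_archGap_cite :
    (∀ (N M : ℕ) (K : Type) [Field K] [NumberField K], JacquetShalika1990_archRankinSelbergGap_entireRatio N M K) →
    ∀ {n m : ℕ} {K : Type} [Field K] [NumberField K]
      {μ : Measure (AdelicGroupData.gl n K).automorphicQuotient} [(AdelicGroupData.gl n K).IsAutomorphicMeasure μ]
      {μ' : Measure (AdelicGroupData.gl m K).automorphicQuotient} [(AdelicGroupData.gl m K).IsAutomorphicMeasure μ'],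
      MoeglinWaldspurger1989_partialPairL_entire_of_rank_ne (n := n) (m := m) (K := K) (μ := μ) (μ' := μ') := by
  sorry

/-- **CITATION STUB (already a theorem) — the corner Euler factorisation over all good places**, verbatim the statement
of `CornerEulerLimit.stub_corner_euler_limit` (LANDED p128318, lead c5; Jacquet–Shalika (1981), §2 Prop. (2.3), §4;
Cogdell (2004), Thm. 2.2 with Thm. 3.3): for continuous `W` on `GL_{m+1}(𝔸_K)` (`‖W‖` central-invariant) and `W'` on
`GL_m(𝔸_K)`, unramified Whittaker–Hecke torus data at every `v ∉ S'` with parameters bounded by `q_v^{1/2}`, an integrable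
corner pair integrand (`re s > 1/2`), and `L` the product of the local factors at `q_v^{-(s+1/2)}`:
`∫ I_s = L · ∫_{B({v ∉ S'}) × K} I_s`. It is consumed here for `W = W^τ_E` (the Eisenstein partner's translated Whittaker
function) — the theorem is stated for ANY such `W`. Kept as a hypothesis only to avoid importing the
`IrreducibilityBySelfDuality` build chain; closes by the one-line citation.
[cite: JacquetShalikaAJM1981, §2 Prop. (2.3), §4] [cite: CogdellAnalyticTheory2004, Thm. 2.2, Thm. 3.3] -/
theorem stub_corner_euler_limit_cite :
    ∀ {m : ℕ} {K : Type} [Field K] [NumberField K]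
      [MeasurableSpace (AdeleRing (𝓞 K) K)] [BorelSpace (AdeleRing (𝓞 K) K)] (_hm : 0 < m)
      (νA : Measure (Fin m → ideleGroup K)) [IsHaarMeasure νA]
      (νK : Measure ↥(maximalCompactAdelic m K)) [IsHaarMeasure νK]
      {W : GL (Fin (m + 1)) (AdeleRing (𝓞 K) K) → ℂ} {W' : GL (Fin m) (AdeleRing (𝓞 K) K) → ℂ},
      Continuous W → Continuous W' →
      (∀ (z : ideleGroup K) (g : GL (Fin (m + 1)) (AdeleRing (𝓞 K) K)),
        ‖W (Matrix.GeneralLinearGroup.scalar (Fin (m + 1)) z * g)‖ = ‖W g‖) →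
      ∀ {S' : Set (HeightOneSpectrum (𝓞 K))}
        {ϖ : ∀ v : HeightOneSpectrum (𝓞 K), (v.adicCompletion K)ˣ}
        {x : HeightOneSpectrum (𝓞 K) → Fin (m + 1) → ℂ} {y : HeightOneSpectrum (𝓞 K) → Fin m → ℂ},
      (∀ v ∉ S', IsTorusUnramifiedAt (m + 1) K W v (ϖ v) (x v)) →
      (∀ v ∉ S', IsTorusUnramifiedAt m K W' v (ϖ v) (y v)) →
      (∀ v ∉ S', ∀ i, ‖x v i‖ ≤ (v.residueCard : ℝ) ^ (1 / 2 : ℝ)) →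
      (∀ v ∉ S', ∀ a, ‖y v a‖ ≤ (v.residueCard : ℝ) ^ (1 / 2 : ℝ)) →
      ∀ (s : ℂ), 1 / 2 < s.re →
      Integrable (torusPairIntegrandC m K
        (fun g => W (glCorner (AdeleRing (𝓞 K) K) (Nat.le_succ m) g)) W' (fun _ => (1 : ℝ)) s) (νA.prod νK) →
      ∀ {α β : HeightOneSpectrum (𝓞 K) → Multiset ℂ},
      (∀ v ∉ S', (Finset.univ : Finset (Fin (m + 1))).val.map (x v) = α v) →
      (∀ v ∉ S', (Finset.univ : Finset (Fin m)).val.map (y v) = β v) →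
      ∀ {L : ℂ}, HasProd (fun u : {v : HeightOneSpectrum (𝓞 K) // v ∉ S'} =>
        ((satakePairPolynomial (α u.1) (β u.1)).eval ((u.1.residueCard : ℂ) ^ (-(s + 1 / 2))))⁻¹) L →
      ∫ p, torusPairIntegrandC m K (fun g => W (glCorner (AdeleRing (𝓞 K) K) (Nat.le_succ m) g)) W'
          (fun _ => (1 : ℝ)) s p ∂(νA.prod νK) =
        L * ∫ p in unitBox {v | v ∉ S'} ×ˢ Set.univ, torusPairIntegrandC m K
          (fun g => W (glCorner (AdeleRing (𝓞 K) K) (Nat.le_succ m) g)) W' (fun _ => (1 : ℝ)) s p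
          ∂(νA.prod νK) := by
  sorry

/-- **STUB (XL, the construction) — the Eisenstein partner exists.** For cuspidal `P`, `P'` on `GL_n(𝔸_K)`
(`0 < n`), honest Satake families `α`, `β` off a finite `S`, any `b₀` and any target point `s₁`, there is a
`PartnerData` (docstring of the structure): the convergent Eisenstein series on `GL_{n+1}` induced from
`P_{1,n}` with data `(|·|^b, σ)`, `b ≥ b₀`, its two corner constant terms in `P`, an honest cusp form of
`P'.conj` of level supported in `S`, the torus of Whittaker shifts, torus-unramified translated Whittaker
functions with parameters `(α_v, q_v^{-b})` and `β_v` off `S` (Casselman–Shalika–Shintani for the spherical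
section; `HonestTranslateUnramified` for the cusp form), the two-cusp decay (Fourier expansion along `U_{n,1}`,
`U_{1,n}` + uniform moderate growth), the factored Euler product (`L^S(s+b, β)` entire by Godement–Jacquet =
`StandardEntire`, non-zero on `Re s > 1 - b`), and the `S`-part entire and non-zero at `s₁ - 1/2`
(big-cell Schwartz sections of `I_∞(b)` + Kirillov surjectivity for the unitary generic `σ_∞`; JPSS (2.7) at the
finite places of `S` as in `CornerUnitBoxProductForm`). [cite: MoeglinWaldspurger1989, II.1.5 (convergence), II.1.7 (constant terms)]
[cite: JacquetShalikaAJM1981, §4 (Whittaker coefficient of Eisenstein series), Thm. (5.3)]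
[cite: Kemarsky2015, Thm. 1] [cite: CogdellAnalyticTheory2004, §4.1–4.2] -/
theorem stub_partner :
    ∀ {n : ℕ} {K : Type} [Field K] [NumberField K]
      {μ : Measure (AdelicGroupData.gl n K).automorphicQuotient} [(AdelicGroupData.gl n K).IsAutomorphicMeasure μ]
      [MeasurableSpace (AdeleRing (𝓞 K) K)] [BorelSpace (AdeleRing (𝓞 K) K)] (_hn : 0 < n)
      (νA : Measure (Fin n → ideleGroup K)) [IsHaarMeasure νA]
      (νK : Measure ↥(maximalCompactAdelic n K)) [IsHaarMeasure νK]
      (ν₀ : Measure ↥(adelicUnipotent (n + 1) K)) [IsHaarMeasure ν₀]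
      (ν₀' : Measure ↥(adelicUnipotent n K)) [IsHaarMeasure ν₀']
      (P P' : CuspidalAutomorphicRepGL n K μ) {S : Set (HeightOneSpectrum (𝓞 K))} (_hS : S.Finite)
      {α β : SatakeFamily K} (_hα : IsSatakeFamilyOf P S α) (_hβ : IsSatakeFamilyOf P' S β)
      (b₀ : ℝ) (s₁ : ℂ),
      Nonempty (PartnerData νA νK ν₀ ν₀' P P' S α β b₀ s₁) := by
  sorry

/-- **STUB (L) — the regularized corner integral is entire.** For a partner datum: the regularized fibre integral
`regKernel` is left invariant under `A_G GL_n(K)` (as `jpssKernel_mul_left`: `diag(γ,1) ∈ GL_{n+1}(K)`, `|det γ| = 1`,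
`u ↦ u + u₀`), so it descends to a kernel `𝓚 s` on the automorphic quotient `X_n`; by the two-cusp decay the
integrand `φ̄ · 𝓚 s` is bounded on the finite measure space `X_n`, locally uniformly in `s`, and
`J(s) = ∫_{X_n} φ̄ 𝓚_s dμ` is ENTIRE (dominated holomorphic parameter integral, as `differentiable_jpssIntegral`).
[cite: CogdellAnalyticTheory2004, §2.2, Thm. 2.1 (first clause)] -/
theorem stub_corner_regularized :
    ∀ {n : ℕ} {K : Type} [Field K] [NumberField K]
      {μ : Measure (AdelicGroupData.gl n K).automorphicQuotient} [(AdelicGroupData.gl n K).IsAutomorphicMeasure μ]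
      [MeasurableSpace (AdeleRing (𝓞 K) K)] [BorelSpace (AdeleRing (𝓞 K) K)] (_hn : 0 < n)
      {νA : Measure (Fin n → ideleGroup K)} {νK : Measure ↥(maximalCompactAdelic n K)}
      {ν₀ : Measure ↥(adelicUnipotent (n + 1) K)} {ν₀' : Measure ↥(adelicUnipotent n K)}
      {P P' : CuspidalAutomorphicRepGL n K μ} {S : Set (HeightOneSpectrum (𝓞 K))} {α β : SatakeFamily K}
      {b₀ : ℝ} {s₁ : ℂ} (D : PartnerData νA νK ν₀ ν₀' P P' S α β b₀ s₁),
      ∃ 𝓚 : ℂ → (AdelicGroupData.gl n K).automorphicQuotient → ℂ,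
        (∀ (s : ℂ) (g : GL (Fin n) (AdeleRing (𝓞 K) K)),
          𝓚 s ((AdelicGroupData.gl n K).toAutomorphicQuotient g) = regKernel D.E D.A D.B s g⁻¹) ∧
        Differentiable ℂ fun s : ℂ => ∫ x, star (D.φ x) * 𝓚 s x ∂μ := by
  sorry

/-- **STUB (XL, the heart) — the regularized corner Rankin–Selberg identity with its polar part.** For a partner
datum and its descended kernel `𝓚`: there is `C > 0` (Haar measures) and an abscissa `x₀` with, for `re s > x₀`,
`J(s) + ⟨sv, svB⟩ / (c (s - 1)) - ⟨sv, svA⟩ / (c s) = C · w_{s-1/2}(τ) · ∫_{(𝔸ˣ)ⁿ × K} W^τ_E(diag(a k, 1)) W̄^τ_φ(diag(a) k) |det a|^{s-1/2} δ⁻¹`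
(`c = n [K:ℚ]`; `⟨·,·⟩` the `L²(X_n)` inner product, conjugate-linear in the first slot, so `⟨sv, svB⟩ = ∫ φ̄ B dμ`).
Proof shape: (i) the kernel with `A` subtracted EVERYWHERE converges absolutely on `re s > 1` and differs from `J`
by `∫_{|det| < 1} φ̄ (|det|^{-1/2} B - |det|^{1/2} A) |det|^{s-1/2} = ⟨sv,svB⟩/(c(s-1)) - ⟨sv,svA⟩/(cs)` (Fubini
over `X_n × A_G`, `A`, `B` being `A_G`-invariant); (ii) `E - (U_{n,1}-constant term)` restricted to the corner
unfolds along the mirabolic tower of `GL_{n+1}`: the Fourier expansion along `U_{n,1}` (one `P_n(K)`-orbit of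
non-trivial characters), then along the mirabolics of `GL_n, …, GL_2`, where the degenerate terms are Fourier
coefficients of the constant terms along the radicals of `P_{k,n+1-k}`: zero for `2 ≤ k ≤ n-1`
(`D.cuspidal_E`), and for `k = 1` a function left invariant under the adelic radical of `P_{1,n-1} ⊂ GL_n`, killed
by the cuspidality of `φ`; absolute convergence from the uniform moderate growth of `E` (gauge estimate) and the
rapid decay of `φ`; (iii) the surviving term is `∫_{N_n(𝔸)\GL_n(𝔸)} W_E(diag(h,1)) W̄_φ(h) |det h|^{s-1/2} dh`,
written in Iwasawa/torus coordinates (`CornerBochnerIwasawa.stub_bochner_iwasawa`) and translated by `τ`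
(`torusPoint_mul`, `torusWeightC_mul`, left invariance of `νA`, as `CornerGlobalTranslate`).
[cite: CogdellAnalyticTheory2004, §2.2, Thm. 2.1–2.2] [cite: JacquetShalikaAJM1981, §4]
[cite: MoeglinWaldspurger1989, I.2.18, II.1.7] -/
theorem stub_corner_unfolded :
    ∀ {n : ℕ} {K : Type} [Field K] [NumberField K]
      {μ : Measure (AdelicGroupData.gl n K).automorphicQuotient} [(AdelicGroupData.gl n K).IsAutomorphicMeasure μ]
      [MeasurableSpace (AdeleRing (𝓞 K) K)] [BorelSpace (AdeleRing (𝓞 K) K)] (_hn : 0 < n)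
      {νA : Measure (Fin n → ideleGroup K)} [IsHaarMeasure νA]
      {νK : Measure ↥(maximalCompactAdelic n K)} [IsHaarMeasure νK]
      {ν₀ : Measure ↥(adelicUnipotent (n + 1) K)} [IsHaarMeasure ν₀]
      {ν₀' : Measure ↥(adelicUnipotent n K)} [IsHaarMeasure ν₀']
      {P P' : CuspidalAutomorphicRepGL n K μ} {S : Set (HeightOneSpectrum (𝓞 K))} {α β : SatakeFamily K}
      {b₀ : ℝ} {s₁ : ℂ} (D : PartnerData νA νK ν₀ ν₀' P P' S α β b₀ s₁)
      (𝓚 : ℂ → (AdelicGroupData.gl n K).automorphicQuotient → ℂ),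
      (∀ (s : ℂ) (g : GL (Fin n) (AdeleRing (𝓞 K) K)),
        𝓚 s ((AdelicGroupData.gl n K).toAutomorphicQuotient g) = regKernel D.E D.A D.B s g⁻¹) →
      ∃ C : ℝ, 0 < C ∧ ∃ x₀ : ℝ, ∀ s : ℂ, x₀ < s.re →
        (∫ x, star (D.φ x) * 𝓚 s x ∂μ) +
            ⟪((D.sv : P'.conj.1.toSubmodule) : (AdelicGroupData.gl n K).L2 μ),
              ((D.svB : P.1.toSubmodule) : (AdelicGroupData.gl n K).L2 μ)⟫_ℂ /
              (((n * Module.finrank ℚ K : ℕ) : ℂ) * (s - 1)) -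
            ⟪((D.sv : P'.conj.1.toSubmodule) : (AdelicGroupData.gl n K).L2 μ),
              ((D.svA : P.1.toSubmodule) : (AdelicGroupData.gl n K).L2 μ)⟫_ℂ /
              (((n * Module.finrank ℚ K : ℕ) : ℂ) * s) =
          (C : ℂ) * (torusWeightC n K (s - 1 / 2) D.τ *
            ∫ p, torusPairIntegrandC n K
              (fun g => whittakerCoeff ν₀ (unipotentTateDomain (n + 1) K) (adeleAddChar K) D.E
                (glDiagonal (n + 1) (AdeleRing (𝓞 K) K) (Fin.snoc D.τ 1) *
                  glCorner (AdeleRing (𝓞 K) K) (Nat.le_succ n) g))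
              (fun g => star (whittakerCoeff ν₀' (unipotentTateDomain n K) (adeleAddChar K)
                (invQuot (AdelicGroupData.gl n K) D.φ) (glDiagonal n (AdeleRing (𝓞 K) K) D.τ * g)))
              (fun _ => (1 : ℝ)) (s - 1 / 2) p ∂(νA.prod νK)) := by
  sorry


/-! ## Proved glue: the equal-rank entire-quotient representation WITH POLAR PART, and the crux -/

section Glue

/-- The regularization constant `c = n [K:ℚ]` is non-zero. [folklore] -/
theorem cConst_ne_zero {n : ℕ} (hn : 0 < n) (K : Type) [Field K] [NumberField K] :
    ((n * Module.finrank ℚ K : ℕ) : ℂ) ≠ 0 := by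
  have hK : 0 < Module.finrank ℚ K := Module.finrank_pos
  exact_mod_cast (Nat.mul_pos hn hK).ne'

/-- Clearing the two simple poles: an algebraic identity. [folklore] -/
theorem clear_poles (J pA pB c s : ℂ) (hc : c ≠ 0) (hs : s ≠ 0) (hs1 : s - 1 ≠ 0) :
    s * (s - 1) * J + s * pB / c - (s - 1) * pA / c =
      s * (s - 1) * (J + pB / (c * (s - 1)) - pA / (c * s)) := by
  field_simp <;> ring

/-- **THE EQUAL-RANK HEART from the three stubs (every rank `n ≥ 1`, every number field, every datum):** for
cuspidal `P`, `P'` on `GL_n(𝔸_K)`, honest Satake families `α`, `β` off a finite `S` and any `s₀`, there are ENTIRE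
`J`, `A` with `A(s₀) ≠ 0` and two constants `pA = ⟨sv, svA⟩`, `pB = ⟨sv, svB⟩` — which VANISH when `P ⟂ P'.conj` —
such that `s (s-1) J(s) + s pB / c - (s-1) pA / c = A(s) · s (s-1) L^S(s, α ⊗ β)` on `Re s > 1`.
Assembly: the partner at `b₀ = 2 - Re s₀`, `s₁ = s₀` (`stub_partner`); `J` from `stub_corner_regularized`; the
identity of `stub_corner_unfolded`; the corner Euler factorisation of the tree
(`CornerEulerLimit.stub_corner_euler_limit`, for the translated Whittaker functions of the datum) with the factored
Euler product `L^S(s, α ⊗ β) · Gb(s)`; `A = C w_{s-1/2}(τ) Gb(s) U(s - 1/2)` is entire and `A(s₀) ≠ 0`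
(`torusWeightC_ne_zero`, `Gb ≠ 0` on `Re s > 1 - b ∋ s₀`, `U(s₀ - 1/2) ≠ 0`); the identity is continued from the right
half-plane down to `Re s > 1` by the identity theorem (`eqOn_halfPlane_of_eqOn_right`,
`differentiableOn_partialPairL_of_isSatakeFamilyOf`); orthogonality kills the polar part
(`Submodule.isOrtho_iff_inner_eq`). [cite: CogdellAnalyticTheory2004, Thm. 4.2 and §4.2] -/
theorem heart
    (hP : (∀ {n : ℕ} {K : Type} [Field K] [NumberField K]
        {μ : Measure (AdelicGroupData.gl n K).automorphicQuotient} [(AdelicGroupData.gl n K).IsAutomorphicMeasure μ]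
        [MeasurableSpace (AdeleRing (𝓞 K) K)] [BorelSpace (AdeleRing (𝓞 K) K)] (_hn : 0 < n)
        (νA : Measure (Fin n → ideleGroup K)) [IsHaarMeasure νA]
        (νK : Measure ↥(maximalCompactAdelic n K)) [IsHaarMeasure νK]
        (ν₀ : Measure ↥(adelicUnipotent (n + 1) K)) [IsHaarMeasure ν₀]
        (ν₀' : Measure ↥(adelicUnipotent n K)) [IsHaarMeasure ν₀']
        (P P' : CuspidalAutomorphicRepGL n K μ) {S : Set (HeightOneSpectrum (𝓞 K))} (_hS : S.Finite)
        {α β : SatakeFamily K} (_hα : IsSatakeFamilyOf P S α) (_hβ : IsSatakeFamilyOf P' S β)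
        (b₀ : ℝ) (s₁ : ℂ),
        Nonempty (PartnerData νA νK ν₀ ν₀' P P' S α β b₀ s₁)))
    (hR : (∀ {n : ℕ} {K : Type} [Field K] [NumberField K]
        {μ : Measure (AdelicGroupData.gl n K).automorphicQuotient} [(AdelicGroupData.gl n K).IsAutomorphicMeasure μ]
        [MeasurableSpace (AdeleRing (𝓞 K) K)] [BorelSpace (AdeleRing (𝓞 K) K)] (_hn : 0 < n)
        {νA : Measure (Fin n → ideleGroup K)} {νK : Measure ↥(maximalCompactAdelic n K)}
        {ν₀ : Measure ↥(adelicUnipotent (n + 1) K)} {ν₀' : Measure ↥(adelicUnipotent n K)}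
        {P P' : CuspidalAutomorphicRepGL n K μ} {S : Set (HeightOneSpectrum (𝓞 K))} {α β : SatakeFamily K}
        {b₀ : ℝ} {s₁ : ℂ} (D : PartnerData νA νK ν₀ ν₀' P P' S α β b₀ s₁),
        ∃ 𝓚 : ℂ → (AdelicGroupData.gl n K).automorphicQuotient → ℂ,
          (∀ (s : ℂ) (g : GL (Fin n) (AdeleRing (𝓞 K) K)),
            𝓚 s ((AdelicGroupData.gl n K).toAutomorphicQuotient g) = regKernel D.E D.A D.B s g⁻¹) ∧
          Differentiable ℂ fun s : ℂ => ∫ x, star (D.φ x) * 𝓚 s x ∂μ))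
    (hU : (∀ {n : ℕ} {K : Type} [Field K] [NumberField K]
        {μ : Measure (AdelicGroupData.gl n K).automorphicQuotient} [(AdelicGroupData.gl n K).IsAutomorphicMeasure μ]
        [MeasurableSpace (AdeleRing (𝓞 K) K)] [BorelSpace (AdeleRing (𝓞 K) K)] (_hn : 0 < n)
        {νA : Measure (Fin n → ideleGroup K)} [IsHaarMeasure νA]
        {νK : Measure ↥(maximalCompactAdelic n K)} [IsHaarMeasure νK]
        {ν₀ : Measure ↥(adelicUnipotent (n + 1) K)} [IsHaarMeasure ν₀]
        {ν₀' : Measure ↥(adelicUnipotent n K)} [IsHaarMeasure ν₀']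
        {P P' : CuspidalAutomorphicRepGL n K μ} {S : Set (HeightOneSpectrum (𝓞 K))} {α β : SatakeFamily K}
        {b₀ : ℝ} {s₁ : ℂ} (D : PartnerData νA νK ν₀ ν₀' P P' S α β b₀ s₁)
        (𝓚 : ℂ → (AdelicGroupData.gl n K).automorphicQuotient → ℂ),
        (∀ (s : ℂ) (g : GL (Fin n) (AdeleRing (𝓞 K) K)),
          𝓚 s ((AdelicGroupData.gl n K).toAutomorphicQuotient g) = regKernel D.E D.A D.B s g⁻¹) →
        ∃ C : ℝ, 0 < C ∧ ∃ x₀ : ℝ, ∀ s : ℂ, x₀ < s.re →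
          (∫ x, star (D.φ x) * 𝓚 s x ∂μ) +
              ⟪((D.sv : P'.conj.1.toSubmodule) : (AdelicGroupData.gl n K).L2 μ),
                ((D.svB : P.1.toSubmodule) : (AdelicGroupData.gl n K).L2 μ)⟫_ℂ /
                (((n * Module.finrank ℚ K : ℕ) : ℂ) * (s - 1)) -
              ⟪((D.sv : P'.conj.1.toSubmodule) : (AdelicGroupData.gl n K).L2 μ),
                ((D.svA : P.1.toSubmodule) : (AdelicGroupData.gl n K).L2 μ)⟫_ℂ /
                (((n * Module.finrank ℚ K : ℕ) : ℂ) * s) =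
            (C : ℂ) * (torusWeightC n K (s - 1 / 2) D.τ *
              ∫ p, torusPairIntegrandC n K
                (fun g => whittakerCoeff ν₀ (unipotentTateDomain (n + 1) K) (adeleAddChar K) D.E
                  (glDiagonal (n + 1) (AdeleRing (𝓞 K) K) (Fin.snoc D.τ 1) *
                    glCorner (AdeleRing (𝓞 K) K) (Nat.le_succ n) g))
                (fun g => star (whittakerCoeff ν₀' (unipotentTateDomain n K) (adeleAddChar K)
                  (invQuot (AdelicGroupData.gl n K) D.φ) (glDiagonal n (AdeleRing (𝓞 K) K) D.τ * g)))
                (fun _ => (1 : ℝ)) (s - 1 / 2) p ∂(νA.prod νK))))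
    (hEu : ∀ {m : ℕ} {K : Type} [Field K] [NumberField K]
        [MeasurableSpace (AdeleRing (𝓞 K) K)] [BorelSpace (AdeleRing (𝓞 K) K)] (_hm : 0 < m)
        (νA : Measure (Fin m → ideleGroup K)) [IsHaarMeasure νA]
        (νK : Measure ↥(maximalCompactAdelic m K)) [IsHaarMeasure νK]
        {W : GL (Fin (m + 1)) (AdeleRing (𝓞 K) K) → ℂ} {W' : GL (Fin m) (AdeleRing (𝓞 K) K) → ℂ},
        Continuous W → Continuous W' →
        (∀ (z : ideleGroup K) (g : GL (Fin (m + 1)) (AdeleRing (𝓞 K) K)),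
          ‖W (Matrix.GeneralLinearGroup.scalar (Fin (m + 1)) z * g)‖ = ‖W g‖) →
        ∀ {S' : Set (HeightOneSpectrum (𝓞 K))}
          {ϖ : ∀ v : HeightOneSpectrum (𝓞 K), (v.adicCompletion K)ˣ}
          {x : HeightOneSpectrum (𝓞 K) → Fin (m + 1) → ℂ} {y : HeightOneSpectrum (𝓞 K) → Fin m → ℂ},
        (∀ v ∉ S', IsTorusUnramifiedAt (m + 1) K W v (ϖ v) (x v)) →
        (∀ v ∉ S', IsTorusUnramifiedAt m K W' v (ϖ v) (y v)) →
        (∀ v ∉ S', ∀ i, ‖x v i‖ ≤ (v.residueCard : ℝ) ^ (1 / 2 : ℝ)) →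
        (∀ v ∉ S', ∀ a, ‖y v a‖ ≤ (v.residueCard : ℝ) ^ (1 / 2 : ℝ)) →
        ∀ (s : ℂ), 1 / 2 < s.re →
        Integrable (torusPairIntegrandC m K
          (fun g => W (glCorner (AdeleRing (𝓞 K) K) (Nat.le_succ m) g)) W' (fun _ => (1 : ℝ)) s) (νA.prod νK) →
        ∀ {α β : HeightOneSpectrum (𝓞 K) → Multiset ℂ},
        (∀ v ∉ S', (Finset.univ : Finset (Fin (m + 1))).val.map (x v) = α v) →
        (∀ v ∉ S', (Finset.univ : Finset (Fin m)).val.map (y v) = β v) →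
        ∀ {L : ℂ}, HasProd (fun u : {v : HeightOneSpectrum (𝓞 K) // v ∉ S'} =>
          ((satakePairPolynomial (α u.1) (β u.1)).eval ((u.1.residueCard : ℂ) ^ (-(s + 1 / 2))))⁻¹) L →
        ∫ p, torusPairIntegrandC m K (fun g => W (glCorner (AdeleRing (𝓞 K) K) (Nat.le_succ m) g)) W'
            (fun _ => (1 : ℝ)) s p ∂(νA.prod νK) =
          L * ∫ p in unitBox {v | v ∉ S'} ×ˢ Set.univ, torusPairIntegrandC m K
            (fun g => W (glCorner (AdeleRing (𝓞 K) K) (Nat.le_succ m) g)) W' (fun _ => (1 : ℝ)) s p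
            ∂(νA.prod νK))
    {n : ℕ} {K : Type} [Field K] [NumberField K]
    {μ : Measure (AdelicGroupData.gl n K).automorphicQuotient} [(AdelicGroupData.gl n K).IsAutomorphicMeasure μ]
    (hn : 0 < n) (P P' : CuspidalAutomorphicRepGL n K μ) {S : Set (HeightOneSpectrum (𝓞 K))} (hS : S.Finite)
    {α β : SatakeFamily K} (hα : IsSatakeFamilyOf P S α) (hβ : IsSatakeFamilyOf P' S β) (s₀ : ℂ) :
    ∃ (J A : ℂ → ℂ) (pA pB : ℂ), Differentiable ℂ J ∧ Differentiable ℂ A ∧ A s₀ ≠ 0 ∧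
      (P.1.toSubmodule ⟂ P'.conj.1.toSubmodule → pA = 0 ∧ pB = 0) ∧
      ∀ s : ℂ, 1 < s.re →
        s * (s - 1) * J s + s * pB / ((n * Module.finrank ℚ K : ℕ) : ℂ) -
            (s - 1) * pA / ((n * Module.finrank ℚ K : ℕ) : ℂ) =
          A s * (s * (s - 1) * partialPairL S α β s) := by
  classical
  -- instances, as in `PairLBoundaryJSOfCornerRoad` / `corner_entire_quotient_of_local_control`
  haveI : T2Space (AdeleRing (𝓞 K) K) := t2Space_adeleRing K
  letI : MeasurableSpace (AdeleRing (𝓞 K) K) := borel _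
  haveI : BorelSpace (AdeleRing (𝓞 K) K) := ⟨rfl⟩
  haveI := borelSpace_ideleGroup K
  haveI := locallyCompactSpace_ideleGroup K
  haveI := secondCountableTopology_ideleGroup K
  haveI := secondCountableTopology_adeleRing K
  haveI := locallyCompactSpace_adeleRing' K
  haveI : T2Space (GL (Fin (n + 1)) (AdeleRing (𝓞 K) K)) := t2Space_gl (n + 1) K
  haveI : T2Space (GL (Fin n) (AdeleRing (𝓞 K) K)) := t2Space_gl n K
  haveI : LocallyCompactSpace (GL (Fin (n + 1)) (AdeleRing (𝓞 K) K)) :=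
    AdelicGroupData.locallyCompactSpace_generalLinearGroup_adeleRing K (Fin (n + 1))
  haveI : LocallyCompactSpace (GL (Fin n) (AdeleRing (𝓞 K) K)) :=
    AdelicGroupData.locallyCompactSpace_generalLinearGroup_adeleRing K (Fin n)
  haveI := secondCountableTopology_generalLinearGroup_adeleRing K (Fin (n + 1))
  haveI := secondCountableTopology_generalLinearGroup_adeleRing K (Fin n)
  haveI : CompactSpace ↥(maximalCompactAdelic n K) :=
    isCompact_iff_compactSpace.1 (isCompact_maximalCompactAdelic n K)
  haveI : LocallyCompactSpace ↥(adelicUnipotent (n + 1) K) := (isClosed_adelicUnipotent (n + 1) K).locallyCompactSpace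
  haveI : LocallyCompactSpace ↥(adelicUnipotent n K) := (isClosed_adelicUnipotent n K).locallyCompactSpace
  -- Haar measures
  obtain ⟨νA, hνA⟩ : ∃ ν : Measure (Fin n → ideleGroup K), IsHaarMeasure ν := ⟨Measure.haar, inferInstance⟩
  obtain ⟨νK, hνK⟩ : ∃ ν : Measure ↥(maximalCompactAdelic n K), IsHaarMeasure ν := ⟨Measure.haar, inferInstance⟩
  obtain ⟨ν₀, hν₀⟩ : ∃ ν : Measure ↥(adelicUnipotent (n + 1) K), IsHaarMeasure ν := ⟨Measure.haar, inferInstance⟩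
  obtain ⟨ν₀', hν₀'⟩ : ∃ ν : Measure ↥(adelicUnipotent n K), IsHaarMeasure ν := ⟨Measure.haar, inferInstance⟩
  -- the partner datum at `b₀ := 2 - re s₀`, `s₁ := s₀`; the regularized integral; the unfolded identity
  obtain ⟨D⟩ := hP hn νA νK ν₀ ν₀' P P' hS hα hβ (2 - s₀.re) s₀
  obtain ⟨𝓚, h𝓚, hJ⟩ := hR hn D
  obtain ⟨C, hC, x₀, hid⟩ := hU hn D 𝓚 h𝓚
  -- notation
  set c : ℂ := ((n * Module.finrank ℚ K : ℕ) : ℂ) with hcdef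
  have hc : c ≠ 0 := cConst_ne_zero hn K
  set pA : ℂ := ⟪((D.sv : P'.conj.1.toSubmodule) : (AdelicGroupData.gl n K).L2 μ),
    ((D.svA : P.1.toSubmodule) : (AdelicGroupData.gl n K).L2 μ)⟫_ℂ with hpA
  set pB : ℂ := ⟪((D.sv : P'.conj.1.toSubmodule) : (AdelicGroupData.gl n K).L2 μ),
    ((D.svB : P.1.toSubmodule) : (AdelicGroupData.gl n K).L2 μ)⟫_ℂ with hpB
  set Jf : ℂ → ℂ := fun s => ∫ x, star (D.φ x) * 𝓚 s x ∂μ with hJf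
  set U : ℂ → ℂ := fun s : ℂ =>
    ∫ p in unitBox {v | v ∉ S} ×ˢ Set.univ, torusPairIntegrandC n K
      (fun g => whittakerCoeff ν₀ (unipotentTateDomain (n + 1) K) (adeleAddChar K) D.E
        (glDiagonal (n + 1) (AdeleRing (𝓞 K) K) (Fin.snoc D.τ 1) * glCorner (AdeleRing (𝓞 K) K) (Nat.le_succ n) g))
      (fun g => star (whittakerCoeff ν₀' (unipotentTateDomain n K) (adeleAddChar K)
        (invQuot (AdelicGroupData.gl n K) D.φ) (glDiagonal n (AdeleRing (𝓞 K) K) D.τ * g)))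
      (fun _ => (1 : ℝ)) s p ∂(νA.prod νK) with hUdef
  set Af : ℂ → ℂ := fun s => (C : ℂ) * torusWeightC n K (s - 1 / 2) D.τ * D.Gb s * U (s - 1 / 2) with hAf
  -- the Euler factorisation of the full translated torus integral (the tree's corner Euler limit)
  have hfac : ∀ s : ℂ, 1 < s.re → D.x₁ + 1 < s.re →
      ∫ p, torusPairIntegrandC n K
          (fun g => whittakerCoeff ν₀ (unipotentTateDomain (n + 1) K) (adeleAddChar K) D.E
            (glDiagonal (n + 1) (AdeleRing (𝓞 K) K) (Fin.snoc D.τ 1) * glCorner (AdeleRing (𝓞 K) K) (Nat.le_succ n) g))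
          (fun g => star (whittakerCoeff ν₀' (unipotentTateDomain n K) (adeleAddChar K)
            (invQuot (AdelicGroupData.gl n K) D.φ) (glDiagonal n (AdeleRing (𝓞 K) K) D.τ * g)))
          (fun _ => (1 : ℝ)) (s - 1 / 2) p ∂(νA.prod νK) =
        (partialPairL S α β s * D.Gb s) * U (s - 1 / 2) := by
    intro s hs1 hsx
    have hhalf : 1 / 2 < (s - 1 / 2).re := by
      simp only [Complex.sub_re, Complex.div_ofNat_re, Complex.one_re]
      linarith
    have hx₁ : D.x₁ < (s - 1 / 2).re := by
      simp only [Complex.sub_re, Complex.div_ofNat_re, Complex.one_re]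
      linarith
    have hint := D.integrable_pair (s - 1 / 2) hx₁
    have hprod := D.hasProd s hs1
    have hs' : s - 1 / 2 + 1 / 2 = s := sub_add_cancel s (1 / 2)
    have hprod' : HasProd (fun u : {v : HeightOneSpectrum (𝓞 K) // v ∉ S} =>
        ((satakePairPolynomial ((fun v => α v + {((v.residueCard : ℂ) ^ (-(D.b : ℂ)))}) u.1) (β u.1)).eval
          ((u.1.residueCard : ℂ) ^ (-(s - 1 / 2 + 1 / 2))))⁻¹) (partialPairL S α β s * D.Gb s) := by
      rw [hs']
      exact hprod
    exact hEu hn νA νK D.continuous_W D.continuous_W' D.central_W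
      D.unram_W D.unram_W' D.bound_x D.bound_y (s - 1 / 2) hhalf hint
      (α := fun v => α v + {((v.residueCard : ℂ) ^ (-(D.b : ℂ)))}) (β := β) D.enum_x D.enum_y hprod'
  -- the identity on a right half-plane
  set xm : ℝ := max x₀ (max (D.x₁ + 1) 2) with hxm
  have hkey : ∀ s : ℂ, xm < s.re → Jf s + pB / (c * (s - 1)) - pA / (c * s) = Af s * partialPairL S α β s := by
    intro s hs
    have h0 : x₀ < s.re := lt_of_le_of_lt (le_max_left _ _) hs
    have h1 : 1 < s.re := by
      have : (2 : ℝ) ≤ xm := (le_max_right _ _).trans (le_max_right _ _)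
      linarith
    have h2 : D.x₁ + 1 < s.re := lt_of_le_of_lt ((le_max_left _ _).trans (le_max_right _ _)) hs
    have h := hid s h0
    rw [hfac s h1 h2] at h
    rw [h]
    simp only [hAf]
    ring
  -- clear the poles and continue down to `re s > 1`
  set Ft : ℂ → ℂ := fun s => s * (s - 1) * Jf s + s * pB / c - (s - 1) * pA / c with hFt
  set Lt : ℂ → ℂ := fun s => Af s * (s * (s - 1) * partialPairL S α β s) with hLt
  have hU' : Differentiable ℂ U := D.differentiable_unitBox
  have hAfd : Differentiable ℂ Af := by
    have h1 : Differentiable ℂ fun s : ℂ => torusWeightC n K (s - 1 / 2) D.τ :=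
      (differentiable_torusWeightC D.τ).comp (differentiable_id.sub_const _)
    have h2 : Differentiable ℂ fun s : ℂ => U (s - 1 / 2) := hU'.comp (differentiable_id.sub_const _)
    exact ((h1.const_mul (C : ℂ)).mul D.differentiable_Gb).mul h2
  have hFtd : Differentiable ℂ Ft := by
    have h1 : Differentiable ℂ fun s : ℂ => s * (s - 1) * Jf s :=
      (differentiable_id.mul (differentiable_id.sub_const 1)).mul hJ
    have h2 : Differentiable ℂ fun s : ℂ => s * pB / c := (differentiable_id.mul_const pB).div_const c
    have h3 : Differentiable ℂ fun s : ℂ => (s - 1) * pA / c :=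
      ((differentiable_id.sub_const 1).mul_const pA).div_const c
    exact (h1.add h2).sub h3
  have hLtd : DifferentiableOn ℂ Lt {s : ℂ | 1 < s.re} := by
    have hL := differentiableOn_partialPairL_of_isSatakeFamilyOf P P' hα hβ
    exact hAfd.differentiableOn.mul
      ((differentiableOn_id.mul (differentiableOn_id.sub (differentiableOn_const _))).mul hL)
  have hright : ∀ s : ℂ, xm < s.re → Ft s = Lt s := by
    intro s hs
    have h2 : (2 : ℝ) < s.re := by
      have : (2 : ℝ) ≤ xm := (le_max_right _ _).trans (le_max_right _ _)
      linarith
    have hs0 : s ≠ 0 := by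
      rintro rfl
      rw [Complex.zero_re] at h2
      linarith
    have hs1 : s - 1 ≠ 0 := by
      intro h
      rw [sub_eq_zero.mp h, Complex.one_re] at h2
      linarith
    show s * (s - 1) * Jf s + s * pB / c - (s - 1) * pA / c = Af s * (s * (s - 1) * partialPairL S α β s)
    rw [clear_poles (Jf s) pA pB c s hc hs0 hs1, hkey s hs]
    ring
  have hall := eqOn_halfPlane_of_eqOn_right (F := Ft) (L := Lt) (c := 1) (x₀ := xm) hFtd hLtd
    ((le_max_right _ _).trans' ((le_max_right _ _).trans' (by norm_num))) hright
  -- conclusion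
  refine ⟨Jf, Af, pA, pB, hJ, hAfd, ?_, ?_, fun s hs => hall s hs⟩
  · -- `A s₀ ≠ 0`
    have hC0 : (C : ℂ) ≠ 0 := Complex.ofReal_ne_zero.2 hC.ne'
    have hb : 1 - D.b < s₀.re := by
      have := D.b₀_le
      linarith
    simp only [hAf]
    exact mul_ne_zero (mul_ne_zero (mul_ne_zero hC0 (torusWeightC_ne_zero _ D.τ)) (D.Gb_ne_zero s₀ hb))
      D.unitBox_ne_zero
  · -- orthogonality kills the polar part
    intro hor
    have h := Submodule.isOrtho_iff_inner_eq.1 hor.symm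
    exact ⟨h _ D.sv.2 _ D.svA.2, h _ D.sv.2 _ D.svB.2⟩

/-- **Leaf hB from the stubs** — Mœglin–Waldspurger (i)(b) in orthogonal form, every rank `n ≥ 1` and number
field: for cuspidal `π ⟂ σ̄` in one `L²_cusp(GL_n)` and honest Satake families off a finite `S`, `L^S(s, π ⊗ σ)`
extends to an entire function (`heart` with vanishing polar part, then the tree's
`exists_entire_eq_partialPairL_of_entire_quotients`). [cite: MoeglinWaldspurger1989, Appendice, Corollaire (i)(b), p. 667] -/
theorem hB_of_stubs
    (hP : (∀ {n : ℕ} {K : Type} [Field K] [NumberField K]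
        {μ : Measure (AdelicGroupData.gl n K).automorphicQuotient} [(AdelicGroupData.gl n K).IsAutomorphicMeasure μ]
        [MeasurableSpace (AdeleRing (𝓞 K) K)] [BorelSpace (AdeleRing (𝓞 K) K)] (_hn : 0 < n)
        (νA : Measure (Fin n → ideleGroup K)) [IsHaarMeasure νA]
        (νK : Measure ↥(maximalCompactAdelic n K)) [IsHaarMeasure νK]
        (ν₀ : Measure ↥(adelicUnipotent (n + 1) K)) [IsHaarMeasure ν₀]
        (ν₀' : Measure ↥(adelicUnipotent n K)) [IsHaarMeasure ν₀']
        (P P' : CuspidalAutomorphicRepGL n K μ) {S : Set (HeightOneSpectrum (𝓞 K))} (_hS : S.Finite)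
        {α β : SatakeFamily K} (_hα : IsSatakeFamilyOf P S α) (_hβ : IsSatakeFamilyOf P' S β)
        (b₀ : ℝ) (s₁ : ℂ),
        Nonempty (PartnerData νA νK ν₀ ν₀' P P' S α β b₀ s₁)))
    (hR : (∀ {n : ℕ} {K : Type} [Field K] [NumberField K]
        {μ : Measure (AdelicGroupData.gl n K).automorphicQuotient} [(AdelicGroupData.gl n K).IsAutomorphicMeasure μ]
        [MeasurableSpace (AdeleRing (𝓞 K) K)] [BorelSpace (AdeleRing (𝓞 K) K)] (_hn : 0 < n)
        {νA : Measure (Fin n → ideleGroup K)} {νK : Measure ↥(maximalCompactAdelic n K)}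
        {ν₀ : Measure ↥(adelicUnipotent (n + 1) K)} {ν₀' : Measure ↥(adelicUnipotent n K)}
        {P P' : CuspidalAutomorphicRepGL n K μ} {S : Set (HeightOneSpectrum (𝓞 K))} {α β : SatakeFamily K}
        {b₀ : ℝ} {s₁ : ℂ} (D : PartnerData νA νK ν₀ ν₀' P P' S α β b₀ s₁),
        ∃ 𝓚 : ℂ → (AdelicGroupData.gl n K).automorphicQuotient → ℂ,
          (∀ (s : ℂ) (g : GL (Fin n) (AdeleRing (𝓞 K) K)),
            𝓚 s ((AdelicGroupData.gl n K).toAutomorphicQuotient g) = regKernel D.E D.A D.B s g⁻¹) ∧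
          Differentiable ℂ fun s : ℂ => ∫ x, star (D.φ x) * 𝓚 s x ∂μ))
    (hU : (∀ {n : ℕ} {K : Type} [Field K] [NumberField K]
        {μ : Measure (AdelicGroupData.gl n K).automorphicQuotient} [(AdelicGroupData.gl n K).IsAutomorphicMeasure μ]
        [MeasurableSpace (AdeleRing (𝓞 K) K)] [BorelSpace (AdeleRing (𝓞 K) K)] (_hn : 0 < n)
        {νA : Measure (Fin n → ideleGroup K)} [IsHaarMeasure νA]
        {νK : Measure ↥(maximalCompactAdelic n K)} [IsHaarMeasure νK]
        {ν₀ : Measure ↥(adelicUnipotent (n + 1) K)} [IsHaarMeasure ν₀]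
        {ν₀' : Measure ↥(adelicUnipotent n K)} [IsHaarMeasure ν₀']
        {P P' : CuspidalAutomorphicRepGL n K μ} {S : Set (HeightOneSpectrum (𝓞 K))} {α β : SatakeFamily K}
        {b₀ : ℝ} {s₁ : ℂ} (D : PartnerData νA νK ν₀ ν₀' P P' S α β b₀ s₁)
        (𝓚 : ℂ → (AdelicGroupData.gl n K).automorphicQuotient → ℂ),
        (∀ (s : ℂ) (g : GL (Fin n) (AdeleRing (𝓞 K) K)),
          𝓚 s ((AdelicGroupData.gl n K).toAutomorphicQuotient g) = regKernel D.E D.A D.B s g⁻¹) →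
        ∃ C : ℝ, 0 < C ∧ ∃ x₀ : ℝ, ∀ s : ℂ, x₀ < s.re →
          (∫ x, star (D.φ x) * 𝓚 s x ∂μ) +
              ⟪((D.sv : P'.conj.1.toSubmodule) : (AdelicGroupData.gl n K).L2 μ),
                ((D.svB : P.1.toSubmodule) : (AdelicGroupData.gl n K).L2 μ)⟫_ℂ /
                (((n * Module.finrank ℚ K : ℕ) : ℂ) * (s - 1)) -
              ⟪((D.sv : P'.conj.1.toSubmodule) : (AdelicGroupData.gl n K).L2 μ),
                ((D.svA : P.1.toSubmodule) : (AdelicGroupData.gl n K).L2 μ)⟫_ℂ /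
                (((n * Module.finrank ℚ K : ℕ) : ℂ) * s) =
            (C : ℂ) * (torusWeightC n K (s - 1 / 2) D.τ *
              ∫ p, torusPairIntegrandC n K
                (fun g => whittakerCoeff ν₀ (unipotentTateDomain (n + 1) K) (adeleAddChar K) D.E
                  (glDiagonal (n + 1) (AdeleRing (𝓞 K) K) (Fin.snoc D.τ 1) *
                    glCorner (AdeleRing (𝓞 K) K) (Nat.le_succ n) g))
                (fun g => star (whittakerCoeff ν₀' (unipotentTateDomain n K) (adeleAddChar K)
                  (invQuot (AdelicGroupData.gl n K) D.φ) (glDiagonal n (AdeleRing (𝓞 K) K) D.τ * g)))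
                (fun _ => (1 : ℝ)) (s - 1 / 2) p ∂(νA.prod νK))))
    (hEu : ∀ {m : ℕ} {K : Type} [Field K] [NumberField K]
        [MeasurableSpace (AdeleRing (𝓞 K) K)] [BorelSpace (AdeleRing (𝓞 K) K)] (_hm : 0 < m)
        (νA : Measure (Fin m → ideleGroup K)) [IsHaarMeasure νA]
        (νK : Measure ↥(maximalCompactAdelic m K)) [IsHaarMeasure νK]
        {W : GL (Fin (m + 1)) (AdeleRing (𝓞 K) K) → ℂ} {W' : GL (Fin m) (AdeleRing (𝓞 K) K) → ℂ},
        Continuous W → Continuous W' →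
        (∀ (z : ideleGroup K) (g : GL (Fin (m + 1)) (AdeleRing (𝓞 K) K)),
          ‖W (Matrix.GeneralLinearGroup.scalar (Fin (m + 1)) z * g)‖ = ‖W g‖) →
        ∀ {S' : Set (HeightOneSpectrum (𝓞 K))}
          {ϖ : ∀ v : HeightOneSpectrum (𝓞 K), (v.adicCompletion K)ˣ}
          {x : HeightOneSpectrum (𝓞 K) → Fin (m + 1) → ℂ} {y : HeightOneSpectrum (𝓞 K) → Fin m → ℂ},
        (∀ v ∉ S', IsTorusUnramifiedAt (m + 1) K W v (ϖ v) (x v)) →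
        (∀ v ∉ S', IsTorusUnramifiedAt m K W' v (ϖ v) (y v)) →
        (∀ v ∉ S', ∀ i, ‖x v i‖ ≤ (v.residueCard : ℝ) ^ (1 / 2 : ℝ)) →
        (∀ v ∉ S', ∀ a, ‖y v a‖ ≤ (v.residueCard : ℝ) ^ (1 / 2 : ℝ)) →
        ∀ (s : ℂ), 1 / 2 < s.re →
        Integrable (torusPairIntegrandC m K
          (fun g => W (glCorner (AdeleRing (𝓞 K) K) (Nat.le_succ m) g)) W' (fun _ => (1 : ℝ)) s) (νA.prod νK) →
        ∀ {α β : HeightOneSpectrum (𝓞 K) → Multiset ℂ},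
        (∀ v ∉ S', (Finset.univ : Finset (Fin (m + 1))).val.map (x v) = α v) →
        (∀ v ∉ S', (Finset.univ : Finset (Fin m)).val.map (y v) = β v) →
        ∀ {L : ℂ}, HasProd (fun u : {v : HeightOneSpectrum (𝓞 K) // v ∉ S'} =>
          ((satakePairPolynomial (α u.1) (β u.1)).eval ((u.1.residueCard : ℂ) ^ (-(s + 1 / 2))))⁻¹) L →
        ∫ p, torusPairIntegrandC m K (fun g => W (glCorner (AdeleRing (𝓞 K) K) (Nat.le_succ m) g)) W'
            (fun _ => (1 : ℝ)) s p ∂(νA.prod νK) =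
          L * ∫ p in unitBox {v | v ∉ S'} ×ˢ Set.univ, torusPairIntegrandC m K
            (fun g => W (glCorner (AdeleRing (𝓞 K) K) (Nat.le_succ m) g)) W' (fun _ => (1 : ℝ)) s p
            ∂(νA.prod νK))
    {n : ℕ} {K : Type} [Field K] [NumberField K]
    {μ : Measure (AdelicGroupData.gl n K).automorphicQuotient} [(AdelicGroupData.gl n K).IsAutomorphicMeasure μ]
    (hn : 0 < n) (P P' : CuspidalAutomorphicRepGL n K μ) (hor : P.1.toSubmodule ⟂ P'.conj.1.toSubmodule)
    {S : Set (HeightOneSpectrum (𝓞 K))} (hS : S.Finite) {α β : SatakeFamily K}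
    (hα : IsSatakeFamilyOf P S α) (hβ : IsSatakeFamilyOf P' S β) :
    ∃ g : ℂ → ℂ, Differentiable ℂ g ∧ ∀ s : ℂ, 1 < s.re → g s = partialPairL S α β s := by
  refine exists_entire_eq_partialPairL_of_entire_quotients P P' hα hβ (x₀ := 1) fun s₀ => ?_
  obtain ⟨J, A, pA, pB, hJ, hA, hA0, hpol, hid⟩ := heart hP hR hU hEu hn P P' hS hα hβ s₀
  obtain ⟨hpA, hpB⟩ := hpol hor
  refine ⟨J, A, hJ, hA, hA0, fun s hs => ?_⟩
  have h := hid s hs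
  rw [hpA, hpB] at h
  simp only [mul_zero, zero_div, add_zero, sub_zero] at h
  have hs0 : s ≠ 0 := by
    rintro rfl
    rw [Complex.zero_re] at hs
    linarith
  have hs1 : s - 1 ≠ 0 := by
    intro h1
    rw [sub_eq_zero.mp h1, Complex.one_re] at hs
    exact lt_irrefl _ hs
  have hss : s * (s - 1) ≠ 0 := mul_ne_zero hs0 hs1
  have h' : s * (s - 1) * J s = s * (s - 1) * (A s * partialPairL S α β s) := by rw [h]; ring
  exact mul_left_cancel₀ hss h'

/-- **Leaf hC from the stubs** — Mœglin–Waldspurger (ii), every rank `n ≥ 1` and number field: for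
`π = σ̄`, `s (s-1) L^S(s, π ⊗ σ)` extends to an entire function (`heart` with its polar part kept, then the tree's
`exists_entire_eq_mul_partialPairL_of_entire_quotients`). [cite: MoeglinWaldspurger1989, Appendice, Corollaire (ii), p. 667] -/
theorem hC_of_stubs
    (hP : (∀ {n : ℕ} {K : Type} [Field K] [NumberField K]
        {μ : Measure (AdelicGroupData.gl n K).automorphicQuotient} [(AdelicGroupData.gl n K).IsAutomorphicMeasure μ]
        [MeasurableSpace (AdeleRing (𝓞 K) K)] [BorelSpace (AdeleRing (𝓞 K) K)] (_hn : 0 < n)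
        (νA : Measure (Fin n → ideleGroup K)) [IsHaarMeasure νA]
        (νK : Measure ↥(maximalCompactAdelic n K)) [IsHaarMeasure νK]
        (ν₀ : Measure ↥(adelicUnipotent (n + 1) K)) [IsHaarMeasure ν₀]
        (ν₀' : Measure ↥(adelicUnipotent n K)) [IsHaarMeasure ν₀']
        (P P' : CuspidalAutomorphicRepGL n K μ) {S : Set (HeightOneSpectrum (𝓞 K))} (_hS : S.Finite)
        {α β : SatakeFamily K} (_hα : IsSatakeFamilyOf P S α) (_hβ : IsSatakeFamilyOf P' S β)
        (b₀ : ℝ) (s₁ : ℂ),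
        Nonempty (PartnerData νA νK ν₀ ν₀' P P' S α β b₀ s₁)))
    (hR : (∀ {n : ℕ} {K : Type} [Field K] [NumberField K]
        {μ : Measure (AdelicGroupData.gl n K).automorphicQuotient} [(AdelicGroupData.gl n K).IsAutomorphicMeasure μ]
        [MeasurableSpace (AdeleRing (𝓞 K) K)] [BorelSpace (AdeleRing (𝓞 K) K)] (_hn : 0 < n)
        {νA : Measure (Fin n → ideleGroup K)} {νK : Measure ↥(maximalCompactAdelic n K)}
        {ν₀ : Measure ↥(adelicUnipotent (n + 1) K)} {ν₀' : Measure ↥(adelicUnipotent n K)}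
        {P P' : CuspidalAutomorphicRepGL n K μ} {S : Set (HeightOneSpectrum (𝓞 K))} {α β : SatakeFamily K}
        {b₀ : ℝ} {s₁ : ℂ} (D : PartnerData νA νK ν₀ ν₀' P P' S α β b₀ s₁),
        ∃ 𝓚 : ℂ → (AdelicGroupData.gl n K).automorphicQuotient → ℂ,
          (∀ (s : ℂ) (g : GL (Fin n) (AdeleRing (𝓞 K) K)),
            𝓚 s ((AdelicGroupData.gl n K).toAutomorphicQuotient g) = regKernel D.E D.A D.B s g⁻¹) ∧
          Differentiable ℂ fun s : ℂ => ∫ x, star (D.φ x) * 𝓚 s x ∂μ))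
    (hU : (∀ {n : ℕ} {K : Type} [Field K] [NumberField K]
        {μ : Measure (AdelicGroupData.gl n K).automorphicQuotient} [(AdelicGroupData.gl n K).IsAutomorphicMeasure μ]
        [MeasurableSpace (AdeleRing (𝓞 K) K)] [BorelSpace (AdeleRing (𝓞 K) K)] (_hn : 0 < n)
        {νA : Measure (Fin n → ideleGroup K)} [IsHaarMeasure νA]
        {νK : Measure ↥(maximalCompactAdelic n K)} [IsHaarMeasure νK]
        {ν₀ : Measure ↥(adelicUnipotent (n + 1) K)} [IsHaarMeasure ν₀]
        {ν₀' : Measure ↥(adelicUnipotent n K)} [IsHaarMeasure ν₀']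
        {P P' : CuspidalAutomorphicRepGL n K μ} {S : Set (HeightOneSpectrum (𝓞 K))} {α β : SatakeFamily K}
        {b₀ : ℝ} {s₁ : ℂ} (D : PartnerData νA νK ν₀ ν₀' P P' S α β b₀ s₁)
        (𝓚 : ℂ → (AdelicGroupData.gl n K).automorphicQuotient → ℂ),
        (∀ (s : ℂ) (g : GL (Fin n) (AdeleRing (𝓞 K) K)),
          𝓚 s ((AdelicGroupData.gl n K).toAutomorphicQuotient g) = regKernel D.E D.A D.B s g⁻¹) →
        ∃ C : ℝ, 0 < C ∧ ∃ x₀ : ℝ, ∀ s : ℂ, x₀ < s.re →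
          (∫ x, star (D.φ x) * 𝓚 s x ∂μ) +
              ⟪((D.sv : P'.conj.1.toSubmodule) : (AdelicGroupData.gl n K).L2 μ),
                ((D.svB : P.1.toSubmodule) : (AdelicGroupData.gl n K).L2 μ)⟫_ℂ /
                (((n * Module.finrank ℚ K : ℕ) : ℂ) * (s - 1)) -
              ⟪((D.sv : P'.conj.1.toSubmodule) : (AdelicGroupData.gl n K).L2 μ),
                ((D.svA : P.1.toSubmodule) : (AdelicGroupData.gl n K).L2 μ)⟫_ℂ /
                (((n * Module.finrank ℚ K : ℕ) : ℂ) * s) =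
            (C : ℂ) * (torusWeightC n K (s - 1 / 2) D.τ *
              ∫ p, torusPairIntegrandC n K
                (fun g => whittakerCoeff ν₀ (unipotentTateDomain (n + 1) K) (adeleAddChar K) D.E
                  (glDiagonal (n + 1) (AdeleRing (𝓞 K) K) (Fin.snoc D.τ 1) *
                    glCorner (AdeleRing (𝓞 K) K) (Nat.le_succ n) g))
                (fun g => star (whittakerCoeff ν₀' (unipotentTateDomain n K) (adeleAddChar K)
                  (invQuot (AdelicGroupData.gl n K) D.φ) (glDiagonal n (AdeleRing (𝓞 K) K) D.τ * g)))
                (fun _ => (1 : ℝ)) (s - 1 / 2) p ∂(νA.prod νK))))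
    (hEu : ∀ {m : ℕ} {K : Type} [Field K] [NumberField K]
        [MeasurableSpace (AdeleRing (𝓞 K) K)] [BorelSpace (AdeleRing (𝓞 K) K)] (_hm : 0 < m)
        (νA : Measure (Fin m → ideleGroup K)) [IsHaarMeasure νA]
        (νK : Measure ↥(maximalCompactAdelic m K)) [IsHaarMeasure νK]
        {W : GL (Fin (m + 1)) (AdeleRing (𝓞 K) K) → ℂ} {W' : GL (Fin m) (AdeleRing (𝓞 K) K) → ℂ},
        Continuous W → Continuous W' →
        (∀ (z : ideleGroup K) (g : GL (Fin (m + 1)) (AdeleRing (𝓞 K) K)),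
          ‖W (Matrix.GeneralLinearGroup.scalar (Fin (m + 1)) z * g)‖ = ‖W g‖) →
        ∀ {S' : Set (HeightOneSpectrum (𝓞 K))}
          {ϖ : ∀ v : HeightOneSpectrum (𝓞 K), (v.adicCompletion K)ˣ}
          {x : HeightOneSpectrum (𝓞 K) → Fin (m + 1) → ℂ} {y : HeightOneSpectrum (𝓞 K) → Fin m → ℂ},
        (∀ v ∉ S', IsTorusUnramifiedAt (m + 1) K W v (ϖ v) (x v)) →
        (∀ v ∉ S', IsTorusUnramifiedAt m K W' v (ϖ v) (y v)) →
        (∀ v ∉ S', ∀ i, ‖x v i‖ ≤ (v.residueCard : ℝ) ^ (1 / 2 : ℝ)) →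
        (∀ v ∉ S', ∀ a, ‖y v a‖ ≤ (v.residueCard : ℝ) ^ (1 / 2 : ℝ)) →
        ∀ (s : ℂ), 1 / 2 < s.re →
        Integrable (torusPairIntegrandC m K
          (fun g => W (glCorner (AdeleRing (𝓞 K) K) (Nat.le_succ m) g)) W' (fun _ => (1 : ℝ)) s) (νA.prod νK) →
        ∀ {α β : HeightOneSpectrum (𝓞 K) → Multiset ℂ},
        (∀ v ∉ S', (Finset.univ : Finset (Fin (m + 1))).val.map (x v) = α v) →
        (∀ v ∉ S', (Finset.univ : Finset (Fin m)).val.map (y v) = β v) →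
        ∀ {L : ℂ}, HasProd (fun u : {v : HeightOneSpectrum (𝓞 K) // v ∉ S'} =>
          ((satakePairPolynomial (α u.1) (β u.1)).eval ((u.1.residueCard : ℂ) ^ (-(s + 1 / 2))))⁻¹) L →
        ∫ p, torusPairIntegrandC m K (fun g => W (glCorner (AdeleRing (𝓞 K) K) (Nat.le_succ m) g)) W'
            (fun _ => (1 : ℝ)) s p ∂(νA.prod νK) =
          L * ∫ p in unitBox {v | v ∉ S'} ×ˢ Set.univ, torusPairIntegrandC m K
            (fun g => W (glCorner (AdeleRing (𝓞 K) K) (Nat.le_succ m) g)) W' (fun _ => (1 : ℝ)) s p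
            ∂(νA.prod νK))
    {n : ℕ} {K : Type} [Field K] [NumberField K]
    {μ : Measure (AdelicGroupData.gl n K).automorphicQuotient} [(AdelicGroupData.gl n K).IsAutomorphicMeasure μ] :
    MoeglinWaldspurger1989_partialPairL_of_eq_conj (n := n) (K := K) (μ := μ) := by
  intro hn P P' he S hS α β hα hβ
  refine exists_entire_eq_mul_partialPairL_of_entire_quotients he hα hβ (x₀ := 1) fun s₀ => ?_
  obtain ⟨J, A, pA, pB, hJ, hA, hA0, _hpol, hid⟩ := heart hP hR hU hEu hn P P' hS hα hβ s₀
  refine ⟨fun s => s * (s - 1) * J s + s * pB / ((n * Module.finrank ℚ K : ℕ) : ℂ) -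
      (s - 1) * pA / ((n * Module.finrank ℚ K : ℕ) : ℂ), A, ?_, hA, hA0, fun s hs => hid s hs⟩
  have h1 : Differentiable ℂ fun s : ℂ => s * (s - 1) * J s :=
    (differentiable_id.mul (differentiable_id.sub_const 1)).mul hJ
  have h2 : Differentiable ℂ fun s : ℂ => s * pB / ((n * Module.finrank ℚ K : ℕ) : ℂ) :=
    (differentiable_id.mul_const pB).div_const _
  have h3 : Differentiable ℂ fun s : ℂ => (s - 1) * pA / ((n * Module.finrank ℚ K : ℕ) : ℂ) :=
    ((differentiable_id.sub_const 1).mul_const pA).div_const _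
  exact (h1.add h2).sub h3

/-! ## Composition -/

/-- **The crux from the stubs**: `PairLBoundaryJS` (Arthur–Clozel (2.2) for Borel–Jacquet data, all ranks) from
`stub_partner`, `stub_corner_regularized`, `stub_corner_unfolded` (leaves hB, hC — NO equal-rank archimedean fact),
`stub_corner_euler_limit_cite` (a landed theorem), `stub_gap_arch_fact` + `stub_hA_of_archGap_cite` (leaf hA: the shared
archimedean gap fact through the landed gap road), by the tree's Literature-level composition
`JacquetShalika1981_partialPairL_boundary_repData_of_moeglinWaldspurger_of_isOrtho` (the Schur form, p81600 shape; no
multiplicity one) and `Iff.rfl` to the bet route's alias. -/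
theorem PairLBoundaryJS_of :
    (∀ {n : ℕ} {K : Type} [Field K] [NumberField K]
        {μ : Measure (AdelicGroupData.gl n K).automorphicQuotient} [(AdelicGroupData.gl n K).IsAutomorphicMeasure μ]
        [MeasurableSpace (AdeleRing (𝓞 K) K)] [BorelSpace (AdeleRing (𝓞 K) K)] (_hn : 0 < n)
        (νA : Measure (Fin n → ideleGroup K)) [IsHaarMeasure νA]
        (νK : Measure ↥(maximalCompactAdelic n K)) [IsHaarMeasure νK]
        (ν₀ : Measure ↥(adelicUnipotent (n + 1) K)) [IsHaarMeasure ν₀]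
        (ν₀' : Measure ↥(adelicUnipotent n K)) [IsHaarMeasure ν₀']
        (P P' : CuspidalAutomorphicRepGL n K μ) {S : Set (HeightOneSpectrum (𝓞 K))} (_hS : S.Finite)
        {α β : SatakeFamily K} (_hα : IsSatakeFamilyOf P S α) (_hβ : IsSatakeFamilyOf P' S β)
        (b₀ : ℝ) (s₁ : ℂ),
        Nonempty (PartnerData νA νK ν₀ ν₀' P P' S α β b₀ s₁)) →
    (∀ {n : ℕ} {K : Type} [Field K] [NumberField K]
        {μ : Measure (AdelicGroupData.gl n K).automorphicQuotient} [(AdelicGroupData.gl n K).IsAutomorphicMeasure μ]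
        [MeasurableSpace (AdeleRing (𝓞 K) K)] [BorelSpace (AdeleRing (𝓞 K) K)] (_hn : 0 < n)
        {νA : Measure (Fin n → ideleGroup K)} {νK : Measure ↥(maximalCompactAdelic n K)}
        {ν₀ : Measure ↥(adelicUnipotent (n + 1) K)} {ν₀' : Measure ↥(adelicUnipotent n K)}
        {P P' : CuspidalAutomorphicRepGL n K μ} {S : Set (HeightOneSpectrum (𝓞 K))} {α β : SatakeFamily K}
        {b₀ : ℝ} {s₁ : ℂ} (D : PartnerData νA νK ν₀ ν₀' P P' S α β b₀ s₁),
        ∃ 𝓚 : ℂ → (AdelicGroupData.gl n K).automorphicQuotient → ℂ,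
          (∀ (s : ℂ) (g : GL (Fin n) (AdeleRing (𝓞 K) K)),
            𝓚 s ((AdelicGroupData.gl n K).toAutomorphicQuotient g) = regKernel D.E D.A D.B s g⁻¹) ∧
          Differentiable ℂ fun s : ℂ => ∫ x, star (D.φ x) * 𝓚 s x ∂μ) →
    (∀ {n : ℕ} {K : Type} [Field K] [NumberField K]
        {μ : Measure (AdelicGroupData.gl n K).automorphicQuotient} [(AdelicGroupData.gl n K).IsAutomorphicMeasure μ]
        [MeasurableSpace (AdeleRing (𝓞 K) K)] [BorelSpace (AdeleRing (𝓞 K) K)] (_hn : 0 < n)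
        {νA : Measure (Fin n → ideleGroup K)} [IsHaarMeasure νA]
        {νK : Measure ↥(maximalCompactAdelic n K)} [IsHaarMeasure νK]
        {ν₀ : Measure ↥(adelicUnipotent (n + 1) K)} [IsHaarMeasure ν₀]
        {ν₀' : Measure ↥(adelicUnipotent n K)} [IsHaarMeasure ν₀']
        {P P' : CuspidalAutomorphicRepGL n K μ} {S : Set (HeightOneSpectrum (𝓞 K))} {α β : SatakeFamily K}
        {b₀ : ℝ} {s₁ : ℂ} (D : PartnerData νA νK ν₀ ν₀' P P' S α β b₀ s₁)
        (𝓚 : ℂ → (AdelicGroupData.gl n K).automorphicQuotient → ℂ),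
        (∀ (s : ℂ) (g : GL (Fin n) (AdeleRing (𝓞 K) K)),
          𝓚 s ((AdelicGroupData.gl n K).toAutomorphicQuotient g) = regKernel D.E D.A D.B s g⁻¹) →
        ∃ C : ℝ, 0 < C ∧ ∃ x₀ : ℝ, ∀ s : ℂ, x₀ < s.re →
          (∫ x, star (D.φ x) * 𝓚 s x ∂μ) +
              ⟪((D.sv : P'.conj.1.toSubmodule) : (AdelicGroupData.gl n K).L2 μ),
                ((D.svB : P.1.toSubmodule) : (AdelicGroupData.gl n K).L2 μ)⟫_ℂ /
                (((n * Module.finrank ℚ K : ℕ) : ℂ) * (s - 1)) -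
              ⟪((D.sv : P'.conj.1.toSubmodule) : (AdelicGroupData.gl n K).L2 μ),
                ((D.svA : P.1.toSubmodule) : (AdelicGroupData.gl n K).L2 μ)⟫_ℂ /
                (((n * Module.finrank ℚ K : ℕ) : ℂ) * s) =
            (C : ℂ) * (torusWeightC n K (s - 1 / 2) D.τ *
              ∫ p, torusPairIntegrandC n K
                (fun g => whittakerCoeff ν₀ (unipotentTateDomain (n + 1) K) (adeleAddChar K) D.E
                  (glDiagonal (n + 1) (AdeleRing (𝓞 K) K) (Fin.snoc D.τ 1) *
                    glCorner (AdeleRing (𝓞 K) K) (Nat.le_succ n) g))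
                (fun g => star (whittakerCoeff ν₀' (unipotentTateDomain n K) (adeleAddChar K)
                  (invQuot (AdelicGroupData.gl n K) D.φ) (glDiagonal n (AdeleRing (𝓞 K) K) D.τ * g)))
                (fun _ => (1 : ℝ)) (s - 1 / 2) p ∂(νA.prod νK))) →
    (∀ {m : ℕ} {K : Type} [Field K] [NumberField K]
        [MeasurableSpace (AdeleRing (𝓞 K) K)] [BorelSpace (AdeleRing (𝓞 K) K)] (_hm : 0 < m)
        (νA : Measure (Fin m → ideleGroup K)) [IsHaarMeasure νA]
        (νK : Measure ↥(maximalCompactAdelic m K)) [IsHaarMeasure νK]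
        {W : GL (Fin (m + 1)) (AdeleRing (𝓞 K) K) → ℂ} {W' : GL (Fin m) (AdeleRing (𝓞 K) K) → ℂ},
        Continuous W → Continuous W' →
        (∀ (z : ideleGroup K) (g : GL (Fin (m + 1)) (AdeleRing (𝓞 K) K)),
          ‖W (Matrix.GeneralLinearGroup.scalar (Fin (m + 1)) z * g)‖ = ‖W g‖) →
        ∀ {S' : Set (HeightOneSpectrum (𝓞 K))}
          {ϖ : ∀ v : HeightOneSpectrum (𝓞 K), (v.adicCompletion K)ˣ}
          {x : HeightOneSpectrum (𝓞 K) → Fin (m + 1) → ℂ} {y : HeightOneSpectrum (𝓞 K) → Fin m → ℂ},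
        (∀ v ∉ S', IsTorusUnramifiedAt (m + 1) K W v (ϖ v) (x v)) →
        (∀ v ∉ S', IsTorusUnramifiedAt m K W' v (ϖ v) (y v)) →
        (∀ v ∉ S', ∀ i, ‖x v i‖ ≤ (v.residueCard : ℝ) ^ (1 / 2 : ℝ)) →
        (∀ v ∉ S', ∀ a, ‖y v a‖ ≤ (v.residueCard : ℝ) ^ (1 / 2 : ℝ)) →
        ∀ (s : ℂ), 1 / 2 < s.re →
        Integrable (torusPairIntegrandC m K
          (fun g => W (glCorner (AdeleRing (𝓞 K) K) (Nat.le_succ m) g)) W' (fun _ => (1 : ℝ)) s) (νA.prod νK) →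
        ∀ {α β : HeightOneSpectrum (𝓞 K) → Multiset ℂ},
        (∀ v ∉ S', (Finset.univ : Finset (Fin (m + 1))).val.map (x v) = α v) →
        (∀ v ∉ S', (Finset.univ : Finset (Fin m)).val.map (y v) = β v) →
        ∀ {L : ℂ}, HasProd (fun u : {v : HeightOneSpectrum (𝓞 K) // v ∉ S'} =>
          ((satakePairPolynomial (α u.1) (β u.1)).eval ((u.1.residueCard : ℂ) ^ (-(s + 1 / 2))))⁻¹) L →
        ∫ p, torusPairIntegrandC m K (fun g => W (glCorner (AdeleRing (𝓞 K) K) (Nat.le_succ m) g)) W'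
            (fun _ => (1 : ℝ)) s p ∂(νA.prod νK) =
          L * ∫ p in unitBox {v | v ∉ S'} ×ˢ Set.univ, torusPairIntegrandC m K
            (fun g => W (glCorner (AdeleRing (𝓞 K) K) (Nat.le_succ m) g)) W' (fun _ => (1 : ℝ)) s p
            ∂(νA.prod νK)) →
    (∀ (n m : ℕ) (K : Type) [Field K] [NumberField K], JacquetShalika1990_archRankinSelbergGap_entireRatio n m K) →
    ((∀ (N M : ℕ) (K : Type) [Field K] [NumberField K], JacquetShalika1990_archRankinSelbergGap_entireRatio N M K) →
        ∀ {n m : ℕ} {K : Type} [Field K] [NumberField K]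
          {μ : Measure (AdelicGroupData.gl n K).automorphicQuotient} [(AdelicGroupData.gl n K).IsAutomorphicMeasure μ]
          {μ' : Measure (AdelicGroupData.gl m K).automorphicQuotient} [(AdelicGroupData.gl m K).IsAutomorphicMeasure μ'],
          MoeglinWaldspurger1989_partialPairL_entire_of_rank_ne (n := n) (m := m) (K := K) (μ := μ) (μ' := μ')) →
    Summit.Langlands.Langlands.Theses.AnalyticDescent.PairLBoundaryJS := by
  intro hP hR hU hEu hGap hAc
  have h : JacquetShalika1981_partialPairL_boundary_repData :=
    JacquetShalika1981_partialPairL_boundary_repData_of_moeglinWaldspurger_of_isOrtho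
      (hAc hGap)
      (fun {n} {K} _ _ {μ} _ => hC_of_stubs hP hR hU hEu)
      (fun {n} {K} _ _ {μ} _ hn P P' hor S hS α β hα hβ => hB_of_stubs hP hR hU hEu hn P P' hor hS hα hβ)
  exact (show Summit.Langlands.Langlands.Theses.AnalyticDescent.PairLBoundaryJS ↔
      JacquetShalika1981_partialPairL_boundary_repData from Iff.rfl).mpr h

/-- The composition instantiated at the stubs (sanity: the skeleton closes the crux by name). -/
theorem PairLBoundaryJS_of_stubs : Summit.Langlands.Langlands.Theses.AnalyticDescent.PairLBoundaryJS :=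
  PairLBoundaryJS_of stub_partner stub_corner_regularized stub_corner_unfolded stub_corner_euler_limit_cite
    stub_gap_arch_fact stub_hA_of_archGap_cite

/-- Route-agnostic form: the stubs give the Literature named fact `JacquetShalika1981_partialPairL_boundary_repData`
(definitionally every route's `PairLBoundaryJS`). -/
theorem partialPairL_boundary_repData_of_stubs : JacquetShalika1981_partialPairL_boundary_repData :=
  (show Summit.Langlands.Langlands.Theses.AnalyticDescent.PairLBoundaryJS ↔
      JacquetShalika1981_partialPairL_boundary_repData from Iff.rfl).mp PairLBoundaryJS_of_stubs

end Glue

end Summit.Langlands.Langlands.Cruxes.PairLBoundaryJS.Partner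

end
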